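import Literature.Algebra.Lie.Sl2ModuleWeights
import Mathlib.Analysis.Complex.Basic
import Mathlib.LinearAlgebra.Matrix.NonsingularInverse
import Mathlib.LinearAlgebra.Matrix.ToLin
import HarnessLib

/-!
# An `𝔰𝔩₂`-triple next to a commuting complex structure: only the weights `-1, 0, 1` occur

Topic `Literature/Algebra/Lie` (namespace `Literature.Algebra.Lie`, dot-notation on Mathlib's `IsSl2Triple`), sequel of
`Sl2ModuleWeights` (Bourbaki, *Lie* VIII §1: `ρ(h)` is diagonalisable with integer weights, `X₊^i | E_{-p}` and
`X₋^i | E_p` are injective for `i ≤ p`).  THEOREMS ONLY (no definition, no instance, no notation, no named fact; D-0026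
net debt `0`).  Written for the lane `lit-hodgefound` (seat `p17`, generation 45) as the representation-theoretic heart
of Moonen–Zarhin's Proposition (3.8), non-CM half (`Literature/Geometry/Kaehler/ComplexTorusHodgeGroupProductNonCMEllipticCurveHom`).

SETTING.  `L` any Lie algebra over `ℂ` with an `𝔰𝔩₂`-triple `(h, e, f)`, `M` a finite-dimensional `L`-module,
`H = ρ(h)`, `E = ρ(e)`, `F = ρ(f)`; an endomorphism `J₁` of `M` commuting with `H`, `E`, `F`; and the hypothesis that
`J = J₁ + i H` is a COMPLEX STRUCTURE: `J² = -1`.  (Dictionary for abelian varieties: `M = H₁(X, ℂ)`, `J` the complex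
structure of `X`, `𝔥𝔤(X)_ℂ = 𝔤₁ ⊕ 𝔤₃` with `𝔤₃ ≅ 𝔰𝔩₂(ℂ)`, `J = J₁ + J₃` with `J₁ ∈ 𝔤₁`, `J₃ = i H ∈ 𝔤₃`.)

PRINTED SOURCE.  B. Moonen, Yu. G. Zarhin, *Hodge classes on abelian varieties of low dimension*, Math. Ann. 315
(1999) [MoonenZarhin1999LowDim], §3 Lemma (3.4), proof (held `paper:arxiv-math_9901113` p0006 L100–L125): «on each of
the summands `U_j^d` the operator `J_X` has `+i` and `-i` as its eigenvalues … If `λ` is an eigenvalue of `J₂` on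
`U_j^{dq}` then we find that both `i + λ` and `-i + λ` occur as eigenvalues of `J_Y` on `U_j^{dq} ⊆ V_{Y,ℂ}`. By
definition of `J_Y` this is possible only if `λ = 0`. We conclude that `J₂` acts trivially», together with §2 (2.2)–(2.3)
(p0003 L105–p0004 L15: «the tautological representation `ρ : 𝔥𝔤(X) → End(V_X)` is a length 1 representation»; for
`𝔰𝔩₂` the only length-1 = minuscule module is the standard one).  Here the same eigenvalue bookkeeping is carried out for
`𝔤₃ = 𝔰𝔩₂(ℂ)` directly on weight vectors, with Bourbaki's Cor. (i)–(ii) of VIII §1 no. 2 Prop. 2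
[Bourbaki2008LieGroups79] (the tree's `IsSl2Triple.iSup_eigenspace_toEnd_h_intCast_eq_top`,
`IsSl2Triple.eq_zero_of_pow_toEnd_e_eq_zero_of_le` / `_f_`) as the only input.

## What is proved (hypotheses: `t : IsSl2Triple h e f`, `J₁` commutes with `H, E, F`, `(J₁ + i H)² = -1`)

* `J E = E J + 2i E`, `J F = F J - 2i F`; `E` kills the `+i`-eigenspace `M⁺` of `J` and maps `M⁻` into `M⁺`, `F` kills
  `M⁻` and maps `M⁺` into `M⁻` (an eigenvalue `±3i` of `J` is impossible); hence
  **`IsSl2Triple.toEnd_e_mul_toEnd_e_eq_zero_of_sq_eq_neg_one`**: `E² = 0`, and `F² = 0` (no finiteness needed).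
* **`IsSl2Triple.intCast_eq_of_hasEigenvalue_of_sq_eq_neg_one`**: every eigenvalue of `H` is `-1`, `0` or `1`
  (the weights of `M⁺` are `0, 1`, those of `M⁻` are `0, -1` — injectivity of `X₊`, `X₋²`); `H³ = H`.
* **`IsSl2Triple.mul_toEnd_h_eq_zero_of_sq_eq_neg_one`**: `J₁ H = 0` — «`J₂` acts trivially» on `𝔤₃ · M = Im H`; so
  `J = J₁` on `Ker H = M^{𝔤₃}` and `J = i H` on `Im H`.
* the STANDARD-ISOTYPIC IDENTITIES `H E = E = -E H`, `H F = -F = -F H`, `E F + F E = H²` (`M = Ker H ⊕ Im H` with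
  `Im H ≅ (std)^m`), whence **`IsSl2Triple.smul_add_mul_self_eq_of_sq_eq_neg_one`**:
  `(a H + b E + c F)² = (a² + b c) H²` for all `a b c : ℂ` (every element of `𝔤₃` squares to `-det · 1` on `Im H`), and
  `s H² = s = H² s`, `J₁ s = 0 = s J₁` for every `s ∈ ℂ H + ℂ E + ℂ F`.

## References

* [MoonenZarhin1999LowDim] B. Moonen, Yu. G. Zarhin, Math. Ann. 315 (1999) 711–733, §2 (2.2)–(2.3), §3 Lemma (3.4) (proof).
* [Bourbaki2008LieGroups79] N. Bourbaki, *Lie Groups and Lie Algebras, Chapters 7–9*, Ch. VIII §1 no. 2, Cor. (i)–(ii) of Prop. 2.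
* [Deligne1982HodgeCycles] P. Deligne, *Hodge cycles on abelian varieties*, LNM 900 (1982), I §3 (weights of `μ` on `V` are `0, 1`).
-/

namespace Literature.Algebra.Lie

open LieModule Module

universe u v

section ComplexStructure

variable {L : Type u} [LieRing L] [LieAlgebra ℂ L] {M : Type v} [AddCommGroup M] [Module ℂ M]
  [LieRingModule L M] [LieModule ℂ L M] {h e f : L} {J₁ : Module.End ℂ M}

/-! ### §0 Operator identities -/

/-- `ρ([x, y]) = ρ(x) ρ(y) - ρ(y) ρ(x)`. [folklore] -/
private theorem toEnd_lie_eq_mul_sub₄₅ (x y : L) :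
    toEnd ℂ L M ⁅x, y⁆ = toEnd ℂ L M x * toEnd ℂ L M y - toEnd ℂ L M y * toEnd ℂ L M x := by
  ext m
  simp only [toEnd_apply_apply, Module.End.mul_apply, LinearMap.sub_apply, lie_lie]

/-- `H E = E H + 2 E`. [cite: Bourbaki2008LieGroups79, Ch. VIII §1 no. 1 Lemma 1] -/
private theorem hE₄₅ (t : IsSl2Triple h e f) :
    toEnd ℂ L M h * toEnd ℂ L M e = toEnd ℂ L M e * toEnd ℂ L M h + (2 : ℂ) • toEnd ℂ L M e := by
  have h1 := toEnd_lie_eq_mul_sub₄₅ (M := M) h e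
  rw [t.lie_h_e_smul ℂ, map_smul] at h1
  rw [h1]; abel

/-- `H F = F H - 2 F`. [cite: Bourbaki2008LieGroups79, Ch. VIII §1 no. 1 Lemma 1] -/
private theorem hF₄₅ (t : IsSl2Triple h e f) :
    toEnd ℂ L M h * toEnd ℂ L M f = toEnd ℂ L M f * toEnd ℂ L M h - (2 : ℂ) • toEnd ℂ L M f := by
  have h1 := toEnd_lie_eq_mul_sub₄₅ (M := M) h f
  rw [t.lie_lie_smul_f ℂ, map_neg, map_smul] at h1
  rw [sub_eq_add_neg, h1]; abel

/-- `E F = F E + H`. [cite: Bourbaki2008LieGroups79, Ch. VIII §1 no. 1] -/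
private theorem eF₄₅ (t : IsSl2Triple h e f) :
    toEnd ℂ L M e * toEnd ℂ L M f = toEnd ℂ L M f * toEnd ℂ L M e + toEnd ℂ L M h := by
  have h1 := toEnd_lie_eq_mul_sub₄₅ (M := M) e f
  rw [t.lie_e_f] at h1
  rw [h1]; abel

/-- `J E = E J + 2i E` for `J = J₁ + i H` with `J₁` commuting with `E`. [cite: MoonenZarhin1999LowDim, §3 Lemma (3.4) (proof)] -/
private theorem J_mul_E₄₅ (t : IsSl2Triple h e f) (hJe : J₁ * toEnd ℂ L M e = toEnd ℂ L M e * J₁) :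
    (J₁ + Complex.I • toEnd ℂ L M h) * toEnd ℂ L M e =
      toEnd ℂ L M e * (J₁ + Complex.I • toEnd ℂ L M h) + (2 * Complex.I) • toEnd ℂ L M e := by
  rw [add_mul, mul_add, smul_mul_assoc, mul_smul_comm, hE₄₅ t, hJe, smul_add, smul_smul, mul_comm Complex.I 2]
  abel

/-- `J F = F J - 2i F`. [cite: MoonenZarhin1999LowDim, §3 Lemma (3.4) (proof)] -/
private theorem J_mul_F₄₅ (t : IsSl2Triple h e f) (hJf : J₁ * toEnd ℂ L M f = toEnd ℂ L M f * J₁) :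
    (J₁ + Complex.I • toEnd ℂ L M h) * toEnd ℂ L M f =
      toEnd ℂ L M f * (J₁ + Complex.I • toEnd ℂ L M h) - (2 * Complex.I) • toEnd ℂ L M f := by
  rw [add_mul, mul_add, smul_mul_assoc, mul_smul_comm, hF₄₅ t, hJf, smul_sub, smul_smul, mul_comm Complex.I 2]
  abel

/-- `J H = H J`. [folklore] -/
private theorem J_mul_H₄₅ (hJh : J₁ * toEnd ℂ L M h = toEnd ℂ L M h * J₁) :
    (J₁ + Complex.I • toEnd ℂ L M h) * toEnd ℂ L M h = toEnd ℂ L M h * (J₁ + Complex.I • toEnd ℂ L M h) := by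
  rw [add_mul, mul_add, smul_mul_assoc, mul_smul_comm, hJh]

/-- An endomorphism with `J² = -1` has no eigenvalue `ν` with `ν² ≠ -1`. [folklore] -/
private theorem eq_zero_of_apply_eq_smul₄₅ {J : Module.End ℂ M} (hJ : J * J = -1) {ν : ℂ} (hν : ν * ν ≠ -1) {x : M}
    (hx : J x = ν • x) : x = 0 := by
  have h1 : (ν * ν + 1) • x = 0 := by
    have h2 : J (J x) = -x := by
      rw [← Module.End.mul_apply, hJ]; rfl
    rw [hx, map_smul, hx, smul_smul] at h2
    rw [add_smul, one_smul, h2, neg_add_cancel]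
  rcases smul_eq_zero.1 h1 with h3 | h3
  · exact absurd (eq_neg_of_add_eq_zero_left h3) hν
  · exact h3

/-! ### §1 `E` kills `M⁺ = Ker(J - i)`, `F` kills `M⁻ = Ker(J + i)`; `E² = 0 = F²` -/

/-- `E m = 0` for `J m = i m`. [cite: MoonenZarhin1999LowDim, §3 Lemma (3.4) (proof: "`i + λ` and `-i + λ` … only if `λ = 0`")] -/
private theorem E_apply_eq_zero_of_pos₄₅ (t : IsSl2Triple h e f) (hJe : J₁ * toEnd ℂ L M e = toEnd ℂ L M e * J₁)
    (hJ : (J₁ + Complex.I • toEnd ℂ L M h) * (J₁ + Complex.I • toEnd ℂ L M h) = -1) {m : M}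
    (hm : (J₁ + Complex.I • toEnd ℂ L M h) m = Complex.I • m) : toEnd ℂ L M e m = 0 := by
  refine eq_zero_of_apply_eq_smul₄₅ hJ (ν := 3 * Complex.I) (by
    rw [show 3 * Complex.I * (3 * Complex.I) = 9 * (Complex.I * Complex.I) by ring, Complex.I_mul_I]; norm_num) ?_
  set J := J₁ + Complex.I • toEnd ℂ L M h with hJdef
  have h1 := congrArg (fun T : Module.End ℂ M ↦ T m) (J_mul_E₄₅ t hJe)
  simp only [← hJdef, Module.End.mul_apply, LinearMap.add_apply, LinearMap.smul_apply, hm, map_smul] at h1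
  rw [h1, ← add_smul]; congr 1; ring

/-- `F m = 0` for `J m = -i m`. [cite: MoonenZarhin1999LowDim, §3 Lemma (3.4) (proof)] -/
private theorem F_apply_eq_zero_of_neg₄₅ (t : IsSl2Triple h e f) (hJf : J₁ * toEnd ℂ L M f = toEnd ℂ L M f * J₁)
    (hJ : (J₁ + Complex.I • toEnd ℂ L M h) * (J₁ + Complex.I • toEnd ℂ L M h) = -1) {m : M}
    (hm : (J₁ + Complex.I • toEnd ℂ L M h) m = -(Complex.I • m)) : toEnd ℂ L M f m = 0 := by
  refine eq_zero_of_apply_eq_smul₄₅ hJ (ν := -(3 * Complex.I)) (by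
    rw [show -(3 * Complex.I) * -(3 * Complex.I) = 9 * (Complex.I * Complex.I) by ring, Complex.I_mul_I]; norm_num) ?_
  set J := J₁ + Complex.I • toEnd ℂ L M h with hJdef
  have h1 := congrArg (fun T : Module.End ℂ M ↦ T m) (J_mul_F₄₅ t hJf)
  simp only [← hJdef, Module.End.mul_apply, LinearMap.sub_apply, LinearMap.smul_apply, hm, map_neg, map_smul] at h1
  rw [h1, ← neg_smul, ← sub_smul]; congr 1; ring

/-- `F` maps `M⁺` into `M⁻`: `J (F m) = -i F m` for `J m = i m`. [cite: MoonenZarhin1999LowDim, §3 Lemma (3.4) (proof)] -/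
private theorem J_F_apply_of_pos₄₅ (t : IsSl2Triple h e f) (hJf : J₁ * toEnd ℂ L M f = toEnd ℂ L M f * J₁) {m : M}
    (hm : (J₁ + Complex.I • toEnd ℂ L M h) m = Complex.I • m) :
    (J₁ + Complex.I • toEnd ℂ L M h) (toEnd ℂ L M f m) = -(Complex.I • toEnd ℂ L M f m) := by
  set J := J₁ + Complex.I • toEnd ℂ L M h with hJdef
  have h1 := congrArg (fun T : Module.End ℂ M ↦ T m) (J_mul_F₄₅ t hJf)
  simp only [← hJdef, Module.End.mul_apply, LinearMap.sub_apply, LinearMap.smul_apply, hm, map_smul] at h1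
  rw [h1, ← neg_smul, ← sub_smul]; congr 1; ring

/-- `E` maps `M⁻` into `M⁺`: `J (E m) = i E m` for `J m = -i m`. [cite: MoonenZarhin1999LowDim, §3 Lemma (3.4) (proof)] -/
private theorem J_E_apply_of_neg₄₅ (t : IsSl2Triple h e f) (hJe : J₁ * toEnd ℂ L M e = toEnd ℂ L M e * J₁) {m : M}
    (hm : (J₁ + Complex.I • toEnd ℂ L M h) m = -(Complex.I • m)) :
    (J₁ + Complex.I • toEnd ℂ L M h) (toEnd ℂ L M e m) = Complex.I • toEnd ℂ L M e m := by
  set J := J₁ + Complex.I • toEnd ℂ L M h with hJdef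
  have h1 := congrArg (fun T : Module.End ℂ M ↦ T m) (J_mul_E₄₅ t hJe)
  simp only [← hJdef, Module.End.mul_apply, LinearMap.add_apply, LinearMap.smul_apply, hm, map_neg, map_smul] at h1
  rw [h1, ← neg_smul, ← add_smul]; congr 1; ring

/-- The two spectral projections of `J` (`J² = -1`): `m = m⁺ + m⁻` with `J m⁺ = i m⁺`, `J m⁻ = -i m⁻`, where
`m⁺ = ½ (m - i J m)`, `m⁻ = ½ (m + i J m)`. [folklore] -/
private theorem decomp₄₅ {J : Module.End ℂ M} (hJ : J * J = -1) (m : M) :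
    J ((2⁻¹ : ℂ) • (m - Complex.I • J m)) = Complex.I • ((2⁻¹ : ℂ) • (m - Complex.I • J m)) ∧
      J ((2⁻¹ : ℂ) • (m + Complex.I • J m)) = -(Complex.I • ((2⁻¹ : ℂ) • (m + Complex.I • J m))) ∧
        (2⁻¹ : ℂ) • (m - Complex.I • J m) + (2⁻¹ : ℂ) • (m + Complex.I • J m) = m := by
  have hJJ : J (J m) = -m := by rw [← Module.End.mul_apply, hJ]; rfl
  have hI : ∀ x : M, Complex.I • Complex.I • x = -x := fun x ↦ by rw [smul_smul, Complex.I_mul_I, neg_one_smul]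
  refine ⟨?_, ?_, ?_⟩
  · rw [map_smul, map_sub, map_smul, hJJ, smul_neg, sub_neg_eq_add, smul_comm Complex.I (2⁻¹ : ℂ), smul_sub, hI,
      sub_neg_eq_add, add_comm (Complex.I • m)]
  · rw [map_smul, map_add, map_smul, hJJ, smul_neg, ← sub_eq_add_neg, smul_comm Complex.I (2⁻¹ : ℂ), smul_add, hI,
      ← sub_eq_add_neg, ← smul_neg, neg_sub]
  · rw [← smul_add, sub_add_add_cancel, ← two_smul ℂ m, smul_smul]; norm_num

/-- **`E² = 0`**: with `J = J₁ + i H` a complex structure commuting as above, `ρ(e)² = 0` (on `M⁺` already `E = 0`, and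
`E M⁻ ⊆ M⁺`). [cite: MoonenZarhin1999LowDim, §3 Lemma (3.4) (proof) and §2 (2.2)] -/
theorem IsSl2Triple.toEnd_e_mul_toEnd_e_eq_zero_of_sq_eq_neg_one (t : IsSl2Triple h e f)
    (hJe : J₁ * toEnd ℂ L M e = toEnd ℂ L M e * J₁)
    (hJ : (J₁ + Complex.I • toEnd ℂ L M h) * (J₁ + Complex.I • toEnd ℂ L M h) = -1) :
    toEnd ℂ L M e * toEnd ℂ L M e = 0 := by
  ext m
  obtain ⟨hp, hn, hm⟩ := decomp₄₅ hJ m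
  rw [Module.End.mul_apply, LinearMap.zero_apply, ← hm, map_add, map_add, E_apply_eq_zero_of_pos₄₅ t hJe hJ hp,
    map_zero, zero_add, E_apply_eq_zero_of_pos₄₅ t hJe hJ (J_E_apply_of_neg₄₅ t hJe hn)]

/-- **`F² = 0`** likewise. [cite: MoonenZarhin1999LowDim, §3 Lemma (3.4) (proof) and §2 (2.2)] -/
theorem IsSl2Triple.toEnd_f_mul_toEnd_f_eq_zero_of_sq_eq_neg_one (t : IsSl2Triple h e f)
    (hJf : J₁ * toEnd ℂ L M f = toEnd ℂ L M f * J₁)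
    (hJ : (J₁ + Complex.I • toEnd ℂ L M h) * (J₁ + Complex.I • toEnd ℂ L M h) = -1) :
    toEnd ℂ L M f * toEnd ℂ L M f = 0 := by
  ext m
  obtain ⟨hp, hn, hm⟩ := decomp₄₅ hJ m
  rw [Module.End.mul_apply, LinearMap.zero_apply, ← hm, map_add, map_add, F_apply_eq_zero_of_neg₄₅ t hJf hJ hn,
    map_zero, add_zero, F_apply_eq_zero_of_neg₄₅ t hJf hJ (J_F_apply_of_pos₄₅ t hJf hp)]


/-- `J₁ m = J m - i H m`. [folklore] -/
private theorem J₁_apply₄₅ (m : M) :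
    J₁ m = (J₁ + Complex.I • toEnd ℂ L M h) m - Complex.I • toEnd ℂ L M h m := by
  rw [LinearMap.add_apply, LinearMap.smul_apply, add_sub_cancel_right]

/-- If `T` commutes with `J` and `T m = μ m`, then `T m⁺ = μ m⁺` for the spectral projection `m⁺ = ½(m - i J m)`. [folklore] -/
private theorem apply_proj_pos₄₅ {J T : Module.End ℂ M} (hTJ : J * T = T * J) {m : M} {μ : ℂ} (hTm : T m = μ • m) :
    T ((2⁻¹ : ℂ) • (m - Complex.I • J m)) = μ • ((2⁻¹ : ℂ) • (m - Complex.I • J m)) := by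
  have hc : T (J m) = J (T m) := by rw [← Module.End.mul_apply, ← hTJ, Module.End.mul_apply]
  rw [map_smul, map_sub, map_smul, hc, hTm, map_smul, smul_comm Complex.I μ, ← smul_sub, smul_comm]

/-- Same for `m⁻ = ½(m + i J m)`. [folklore] -/
private theorem apply_proj_neg₄₅ {J T : Module.End ℂ M} (hTJ : J * T = T * J) {m : M} {μ : ℂ} (hTm : T m = μ • m) :
    T ((2⁻¹ : ℂ) • (m + Complex.I • J m)) = μ • ((2⁻¹ : ℂ) • (m + Complex.I • J m)) := by
  have hc : T (J m) = J (T m) := by rw [← Module.End.mul_apply, ← hTJ, Module.End.mul_apply]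
  rw [map_smul, map_add, map_smul, hc, hTm, map_smul, smul_comm Complex.I μ, ← smul_add, smul_comm]

/-! ### §2 The weights: `0, 1` on `M⁺`, `0, -1` on `M⁻` (finite-dimensional `M`) -/

variable [Module.Finite ℂ M]

/-- A weight vector of `H` inside `M⁺` has weight `0` or `1` (`X₊ m = 0` and `X₋² m = 0`, injectivity of the strings).
[cite: Bourbaki2008LieGroups79, Ch. VIII §1 no. 2 Cor. (ii) of Prop. 2] [cite: MoonenZarhin1999LowDim, §3 Lemma (3.4) (proof)] -/
private theorem weight_pos₄₅ (t : IsSl2Triple h e f) (hJe : J₁ * toEnd ℂ L M e = toEnd ℂ L M e * J₁)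
    (hJf : J₁ * toEnd ℂ L M f = toEnd ℂ L M f * J₁)
    (hJ : (J₁ + Complex.I • toEnd ℂ L M h) * (J₁ + Complex.I • toEnd ℂ L M h) = -1) {m : M}
    (hm : (J₁ + Complex.I • toEnd ℂ L M h) m = Complex.I • m) {n : ℤ} (hn : toEnd ℂ L M h m = (n : ℂ) • m)
    (hm0 : m ≠ 0) : n = 0 ∨ n = 1 := by
  have hE : toEnd ℂ L M e m = 0 := E_apply_eq_zero_of_pos₄₅ t hJe hJ hm
  have hFF : toEnd ℂ L M f (toEnd ℂ L M f m) = 0 :=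
    F_apply_eq_zero_of_neg₄₅ t hJf hJ (J_F_apply_of_pos₄₅ t hJf hm)
  have h1 : ¬ n < 0 := by
    intro hlt
    obtain ⟨p, hp⟩ : ∃ p : ℕ, (p : ℤ) = -n := ⟨(-n).toNat, Int.toNat_of_nonneg (by omega)⟩
    have hx : ⁅h, m⁆ = -(p : ℂ) • m := by
      rw [← toEnd_apply_apply (R := ℂ), hn, show (n : ℂ) = -(p : ℂ) by rw [← Int.cast_natCast (R := ℂ), hp, Int.cast_neg, neg_neg]]
    exact hm0 (IsSl2Triple.eq_zero_of_pow_toEnd_e_eq_zero_of_le (k := ℂ) t (i := 1) (p := p) (by omega) hx (by rw [pow_one, hE]))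
  have h2 : ¬ 2 ≤ n := by
    intro hle
    obtain ⟨p, hp⟩ : ∃ p : ℕ, (p : ℤ) = n := ⟨n.toNat, Int.toNat_of_nonneg (by omega)⟩
    have hx : ⁅h, m⁆ = (p : ℂ) • m := by
      rw [← toEnd_apply_apply (R := ℂ), hn, ← hp, Int.cast_natCast]
    exact hm0 (IsSl2Triple.eq_zero_of_pow_toEnd_f_eq_zero_of_le (k := ℂ) t (i := 2) (p := p) (by omega) hx
      (by rw [pow_two, Module.End.mul_apply, hFF]))
  omega

/-- A weight vector of `H` inside `M⁻` has weight `0` or `-1`. [cite: Bourbaki2008LieGroups79, Ch. VIII §1 no. 2 Cor. (ii) of Prop. 2]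
[cite: MoonenZarhin1999LowDim, §3 Lemma (3.4) (proof)] -/
private theorem weight_neg₄₅ (t : IsSl2Triple h e f) (hJe : J₁ * toEnd ℂ L M e = toEnd ℂ L M e * J₁)
    (hJf : J₁ * toEnd ℂ L M f = toEnd ℂ L M f * J₁)
    (hJ : (J₁ + Complex.I • toEnd ℂ L M h) * (J₁ + Complex.I • toEnd ℂ L M h) = -1) {m : M}
    (hm : (J₁ + Complex.I • toEnd ℂ L M h) m = -(Complex.I • m)) {n : ℤ} (hn : toEnd ℂ L M h m = (n : ℂ) • m)
    (hm0 : m ≠ 0) : n = 0 ∨ n = -1 := by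
  have hF : toEnd ℂ L M f m = 0 := F_apply_eq_zero_of_neg₄₅ t hJf hJ hm
  have hEE : toEnd ℂ L M e (toEnd ℂ L M e m) = 0 :=
    E_apply_eq_zero_of_pos₄₅ t hJe hJ (J_E_apply_of_neg₄₅ t hJe hm)
  have h1 : ¬ 0 < n := by
    intro hlt
    obtain ⟨p, hp⟩ : ∃ p : ℕ, (p : ℤ) = n := ⟨n.toNat, Int.toNat_of_nonneg (by omega)⟩
    have hx : ⁅h, m⁆ = (p : ℂ) • m := by
      rw [← toEnd_apply_apply (R := ℂ), hn, ← hp, Int.cast_natCast]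
    exact hm0 (IsSl2Triple.eq_zero_of_pow_toEnd_f_eq_zero_of_le (k := ℂ) t (i := 1) (p := p) (by omega) hx (by rw [pow_one, hF]))
  have h2 : ¬ n ≤ -2 := by
    intro hle
    obtain ⟨p, hp⟩ : ∃ p : ℕ, (p : ℤ) = -n := ⟨(-n).toNat, Int.toNat_of_nonneg (by omega)⟩
    have hx : ⁅h, m⁆ = -(p : ℂ) • m := by
      rw [← toEnd_apply_apply (R := ℂ), hn, show (n : ℂ) = -(p : ℂ) by rw [← Int.cast_natCast (R := ℂ), hp, Int.cast_neg, neg_neg]]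
    exact hm0 (IsSl2Triple.eq_zero_of_pow_toEnd_e_eq_zero_of_le (k := ℂ) t (i := 2) (p := p) (by omega) hx
      (by rw [pow_two, Module.End.mul_apply, hEE]))
  omega

/-- The four-piece extensionality: two endomorphisms agreeing on `M⁺ ∩ Ker H`, `M⁺ ∩ Ker(H - 1)`, `M⁻ ∩ Ker H`,
`M⁻ ∩ Ker(H + 1)` are equal (`H` is diagonalisable with integer weights, and only these pieces are non-zero).
[cite: Bourbaki2008LieGroups79, Ch. VIII §1 no. 2 Cor. (i) of Prop. 2] -/
private theorem ext_of_pieces₄₅ (t : IsSl2Triple h e f) (hJh : J₁ * toEnd ℂ L M h = toEnd ℂ L M h * J₁)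
    (hJe : J₁ * toEnd ℂ L M e = toEnd ℂ L M e * J₁) (hJf : J₁ * toEnd ℂ L M f = toEnd ℂ L M f * J₁)
    (hJ : (J₁ + Complex.I • toEnd ℂ L M h) * (J₁ + Complex.I • toEnd ℂ L M h) = -1) {T T' : Module.End ℂ M}
    (h₁ : ∀ m, (J₁ + Complex.I • toEnd ℂ L M h) m = Complex.I • m → toEnd ℂ L M h m = 0 → T m = T' m)
    (h₂ : ∀ m, (J₁ + Complex.I • toEnd ℂ L M h) m = Complex.I • m → toEnd ℂ L M h m = m → T m = T' m)
    (h₃ : ∀ m, (J₁ + Complex.I • toEnd ℂ L M h) m = -(Complex.I • m) → toEnd ℂ L M h m = 0 → T m = T' m)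
    (h₄ : ∀ m, (J₁ + Complex.I • toEnd ℂ L M h) m = -(Complex.I • m) → toEnd ℂ L M h m = -m → T m = T' m) :
    T = T' := by
  set J := J₁ + Complex.I • toEnd ℂ L M h with hJdef
  have hHJ : J * toEnd ℂ L M h = toEnd ℂ L M h * J := J_mul_H₄₅ hJh
  ext m
  have hm : m ∈ ⨆ n : ℤ, Module.End.eigenspace (toEnd ℂ L M h) (n : ℂ) := by
    rw [IsSl2Triple.iSup_eigenspace_toEnd_h_intCast_eq_top (M := M) t]; exact Submodule.mem_top
  refine Submodule.iSup_induction _ (motive := fun m ↦ T m = T' m) hm (fun n m hmn ↦ ?_) (by simp)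
    (fun x y hx hy ↦ by rw [map_add, map_add, hx, hy])
  rw [Module.End.mem_eigenspace_iff] at hmn
  obtain ⟨hp, hq, hsum⟩ := decomp₄₅ hJ m
  have hHp := apply_proj_pos₄₅ hHJ hmn
  have hHq := apply_proj_neg₄₅ hHJ hmn
  set mp := (2⁻¹ : ℂ) • (m - Complex.I • J m)
  set mq := (2⁻¹ : ℂ) • (m + Complex.I • J m)
  have hTp : T mp = T' mp := by
    by_cases h0 : mp = 0
    · rw [h0, map_zero, map_zero]
    rcases weight_pos₄₅ t hJe hJf hJ hp hHp h0 with hn | hn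
    · exact h₁ mp hp (by rw [hHp, hn, Int.cast_zero, zero_smul])
    · exact h₂ mp hp (by rw [hHp, hn, Int.cast_one, one_smul])
  have hTq : T mq = T' mq := by
    by_cases h0 : mq = 0
    · rw [h0, map_zero, map_zero]
    rcases weight_neg₄₅ t hJe hJf hJ hq hHq h0 with hn | hn
    · exact h₃ mq hq (by rw [hHq, hn, Int.cast_zero, zero_smul])
    · exact h₄ mq hq (by rw [hHq, hn, Int.cast_neg, Int.cast_one, neg_one_smul])
  rw [← hsum, map_add, map_add, hTp, hTq]

/-- On `M⁺ ∩ Ker H`, `F = 0` (its image would have weight `-2` in `M⁻`). [cite: MoonenZarhin1999LowDim, §3 Lemma (3.4) (proof)] -/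
private theorem F_apply_eq_zero_of_pos_zero₄₅ (t : IsSl2Triple h e f) (hJe : J₁ * toEnd ℂ L M e = toEnd ℂ L M e * J₁)
    (hJf : J₁ * toEnd ℂ L M f = toEnd ℂ L M f * J₁)
    (hJ : (J₁ + Complex.I • toEnd ℂ L M h) * (J₁ + Complex.I • toEnd ℂ L M h) = -1) {m : M}
    (hm : (J₁ + Complex.I • toEnd ℂ L M h) m = Complex.I • m) (hHm : toEnd ℂ L M h m = 0) : toEnd ℂ L M f m = 0 := by
  by_contra h0
  have hw : toEnd ℂ L M h (toEnd ℂ L M f m) = ((-2 : ℤ) : ℂ) • toEnd ℂ L M f m := by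
    have h1 := congrArg (fun T : Module.End ℂ M ↦ T m) (hF₄₅ (M := M) t)
    simp only [Module.End.mul_apply, LinearMap.sub_apply, LinearMap.smul_apply, hHm, map_zero, zero_sub] at h1
    rw [h1, ← neg_smul]; norm_num
  rcases weight_neg₄₅ t hJe hJf hJ (J_F_apply_of_pos₄₅ t hJf hm) hw h0 with h | h <;> omega

/-- On `M⁻ ∩ Ker H`, `E = 0`. [cite: MoonenZarhin1999LowDim, §3 Lemma (3.4) (proof)] -/
private theorem E_apply_eq_zero_of_neg_zero₄₅ (t : IsSl2Triple h e f) (hJe : J₁ * toEnd ℂ L M e = toEnd ℂ L M e * J₁)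
    (hJf : J₁ * toEnd ℂ L M f = toEnd ℂ L M f * J₁)
    (hJ : (J₁ + Complex.I • toEnd ℂ L M h) * (J₁ + Complex.I • toEnd ℂ L M h) = -1) {m : M}
    (hm : (J₁ + Complex.I • toEnd ℂ L M h) m = -(Complex.I • m)) (hHm : toEnd ℂ L M h m = 0) :
    toEnd ℂ L M e m = 0 := by
  by_contra h0
  have hw : toEnd ℂ L M h (toEnd ℂ L M e m) = ((2 : ℤ) : ℂ) • toEnd ℂ L M e m := by
    have h1 := congrArg (fun T : Module.End ℂ M ↦ T m) (hE₄₅ (M := M) t)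
    simp only [Module.End.mul_apply, LinearMap.add_apply, LinearMap.smul_apply, hHm, map_zero, zero_add] at h1
    rw [h1]; norm_num
  rcases weight_pos₄₅ t hJe hJf hJ (J_E_apply_of_neg₄₅ t hJe hm) hw h0 with h | h <;> omega

omit [Module.Finite ℂ M] in
/-- On `M⁺ ∩ Ker(H - 1)`: `E F m = m` and `H (F m) = -F m`. [cite: Bourbaki2008LieGroups79, Ch. VIII §1 no. 2 Prop. 1 (2)] -/
private theorem EF_apply_of_pos_one₄₅ (t : IsSl2Triple h e f) (hJe : J₁ * toEnd ℂ L M e = toEnd ℂ L M e * J₁)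
    (hJ : (J₁ + Complex.I • toEnd ℂ L M h) * (J₁ + Complex.I • toEnd ℂ L M h) = -1) {m : M}
    (hm : (J₁ + Complex.I • toEnd ℂ L M h) m = Complex.I • m) (hHm : toEnd ℂ L M h m = m) :
    toEnd ℂ L M e (toEnd ℂ L M f m) = m ∧ toEnd ℂ L M h (toEnd ℂ L M f m) = -toEnd ℂ L M f m := by
  have hE : toEnd ℂ L M e m = 0 := E_apply_eq_zero_of_pos₄₅ t hJe hJ hm
  constructor
  · have h1 := congrArg (fun T : Module.End ℂ M ↦ T m) (eF₄₅ (M := M) t)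
    simp only [Module.End.mul_apply, LinearMap.add_apply, hE, map_zero, zero_add, hHm] at h1
    exact h1
  · have h1 := congrArg (fun T : Module.End ℂ M ↦ T m) (hF₄₅ (M := M) t)
    simp only [Module.End.mul_apply, LinearMap.sub_apply, LinearMap.smul_apply, hHm] at h1
    rw [h1, two_smul]; abel

omit [Module.Finite ℂ M] in
/-- On `M⁻ ∩ Ker(H + 1)`: `F E m = m` and `H (E m) = E m`. [cite: Bourbaki2008LieGroups79, Ch. VIII §1 no. 2 Prop. 1 (2)] -/
private theorem FE_apply_of_neg_one₄₅ (t : IsSl2Triple h e f) (hJf : J₁ * toEnd ℂ L M f = toEnd ℂ L M f * J₁)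
    (hJ : (J₁ + Complex.I • toEnd ℂ L M h) * (J₁ + Complex.I • toEnd ℂ L M h) = -1) {m : M}
    (hm : (J₁ + Complex.I • toEnd ℂ L M h) m = -(Complex.I • m)) (hHm : toEnd ℂ L M h m = -m) :
    toEnd ℂ L M f (toEnd ℂ L M e m) = m ∧ toEnd ℂ L M h (toEnd ℂ L M e m) = toEnd ℂ L M e m := by
  have hF : toEnd ℂ L M f m = 0 := F_apply_eq_zero_of_neg₄₅ t hJf hJ hm
  constructor
  · have h1 := congrArg (fun T : Module.End ℂ M ↦ T m) (eF₄₅ (M := M) t)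
    simp only [Module.End.mul_apply, LinearMap.add_apply, hF, map_zero, hHm] at h1
    rw [← sub_eq_zero, sub_eq_add_neg]; exact h1.symm
  · have h1 := congrArg (fun T : Module.End ℂ M ↦ T m) (hE₄₅ (M := M) t)
    simp only [Module.End.mul_apply, LinearMap.add_apply, LinearMap.smul_apply, hHm, map_neg] at h1
    rw [h1, two_smul]; abel

/-! ### §3 «`J₂` acts trivially»: `J₁ H = 0`; the weights of `H` are `-1, 0, 1` -/

/-- **`J₁ H = 0`** («we conclude that `J₂` acts trivially on each factor»: the part `J₁` of the complex structure commuting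
with the triple vanishes on `Im H = 𝔤₃ · M`). [cite: MoonenZarhin1999LowDim, §3 Lemma (3.4) (proof)] -/
theorem IsSl2Triple.mul_toEnd_h_eq_zero_of_sq_eq_neg_one (t : IsSl2Triple h e f)
    (hJh : J₁ * toEnd ℂ L M h = toEnd ℂ L M h * J₁) (hJe : J₁ * toEnd ℂ L M e = toEnd ℂ L M e * J₁)
    (hJf : J₁ * toEnd ℂ L M f = toEnd ℂ L M f * J₁)
    (hJ : (J₁ + Complex.I • toEnd ℂ L M h) * (J₁ + Complex.I • toEnd ℂ L M h) = -1) :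
    J₁ * toEnd ℂ L M h = 0 := by
  refine ext_of_pieces₄₅ t hJh hJe hJf hJ (fun m _ hH ↦ ?_) (fun m hm hH ↦ ?_) (fun m _ hH ↦ ?_) (fun m hm hH ↦ ?_)
  · rw [Module.End.mul_apply, hH, map_zero, LinearMap.zero_apply]
  · rw [Module.End.mul_apply, hH, LinearMap.zero_apply, J₁_apply₄₅ (h := h), hm, hH, sub_self]
  · rw [Module.End.mul_apply, hH, map_zero, LinearMap.zero_apply]
  · rw [Module.End.mul_apply, hH, map_neg, LinearMap.zero_apply, J₁_apply₄₅ (h := h), hm, hH, smul_neg, sub_neg_eq_add,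
      neg_add_cancel, neg_zero]

/-- **`H³ = H`**: the weights of `H` lie in `{-1, 0, 1}`. [cite: MoonenZarhin1999LowDim, §2 (2.2)–(2.3) and §3 Lemma (3.4) (proof)]
[cite: Bourbaki2008LieGroups79, Ch. VIII §1 no. 2 Cor. (i)–(ii) of Prop. 2] -/
theorem IsSl2Triple.toEnd_h_mul_self_mul_self_of_sq_eq_neg_one (t : IsSl2Triple h e f)
    (hJh : J₁ * toEnd ℂ L M h = toEnd ℂ L M h * J₁) (hJe : J₁ * toEnd ℂ L M e = toEnd ℂ L M e * J₁)
    (hJf : J₁ * toEnd ℂ L M f = toEnd ℂ L M f * J₁)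
    (hJ : (J₁ + Complex.I • toEnd ℂ L M h) * (J₁ + Complex.I • toEnd ℂ L M h) = -1) :
    toEnd ℂ L M h * toEnd ℂ L M h * toEnd ℂ L M h = toEnd ℂ L M h := by
  refine ext_of_pieces₄₅ t hJh hJe hJf hJ (fun m _ hH ↦ ?_) (fun m _ hH ↦ ?_) (fun m _ hH ↦ ?_) (fun m _ hH ↦ ?_) <;>
    simp only [Module.End.mul_apply, hH, map_zero, map_neg, neg_neg]

/-- **The eigenvalues of `H` are `-1`, `0`, `1`** (only the trivial and the standard `𝔰𝔩₂`-modules occur in `M` — «`V_X`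
is the only length 1 irreducible module»). [cite: MoonenZarhin1999LowDim, §2 (2.2)–(2.3) and §3 Lemma (3.4)]
[cite: Bourbaki2008LieGroups79, Ch. VIII §1 no. 2 Cor. (i)–(ii) of Prop. 2] -/
theorem IsSl2Triple.eq_of_hasEigenvalue_toEnd_h_of_sq_eq_neg_one (t : IsSl2Triple h e f)
    (hJh : J₁ * toEnd ℂ L M h = toEnd ℂ L M h * J₁) (hJe : J₁ * toEnd ℂ L M e = toEnd ℂ L M e * J₁)
    (hJf : J₁ * toEnd ℂ L M f = toEnd ℂ L M f * J₁)
    (hJ : (J₁ + Complex.I • toEnd ℂ L M h) * (J₁ + Complex.I • toEnd ℂ L M h) = -1) {μ : ℂ}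
    (hμ : (toEnd ℂ L M h).HasEigenvalue μ) : μ = -1 ∨ μ = 0 ∨ μ = 1 := by
  obtain ⟨x, hx⟩ := hμ.exists_hasEigenvector
  have hx1 : toEnd ℂ L M h x = μ • x := Module.End.mem_eigenspace_iff.1 hx.1
  have h3 := congrArg (fun T : Module.End ℂ M ↦ T x) (IsSl2Triple.toEnd_h_mul_self_mul_self_of_sq_eq_neg_one t hJh hJe hJf hJ)
  simp only [Module.End.mul_apply, hx1, map_smul, smul_smul] at h3
  rw [← sub_eq_zero, ← sub_smul, smul_eq_zero] at h3
  rcases h3 with h3 | h3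
  · have h4 : μ * (μ - 1) * (μ + 1) = 0 := by linear_combination h3
    rcases mul_eq_zero.1 h4 with h5 | h5
    · rcases mul_eq_zero.1 h5 with h6 | h6
      · exact Or.inr (Or.inl h6)
      · exact Or.inr (Or.inr (sub_eq_zero.1 h6))
    · exact Or.inl (eq_neg_of_add_eq_zero_left h5)
  · exact absurd h3 hx.2

/-! ### §4 The standard-isotypic identities and the square of an element of `ℂ H + ℂ E + ℂ F` -/

/-- **`H E = E`.** [cite: Bourbaki2008LieGroups79, Ch. VIII §1 no. 2 Prop. 1 (2) and no. 3 Thm. 1] [cite: MoonenZarhin1999LowDim, §3 Lemma (3.4)] -/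
theorem IsSl2Triple.toEnd_h_mul_toEnd_e_of_sq_eq_neg_one (t : IsSl2Triple h e f)
    (hJh : J₁ * toEnd ℂ L M h = toEnd ℂ L M h * J₁) (hJe : J₁ * toEnd ℂ L M e = toEnd ℂ L M e * J₁)
    (hJf : J₁ * toEnd ℂ L M f = toEnd ℂ L M f * J₁)
    (hJ : (J₁ + Complex.I • toEnd ℂ L M h) * (J₁ + Complex.I • toEnd ℂ L M h) = -1) :
    toEnd ℂ L M h * toEnd ℂ L M e = toEnd ℂ L M e := by
  refine ext_of_pieces₄₅ t hJh hJe hJf hJ (fun m hm _ ↦ ?_) (fun m hm _ ↦ ?_) (fun m hm hH ↦ ?_) (fun m hm hH ↦ ?_)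
  · rw [Module.End.mul_apply, E_apply_eq_zero_of_pos₄₅ t hJe hJ hm, map_zero]
  · rw [Module.End.mul_apply, E_apply_eq_zero_of_pos₄₅ t hJe hJ hm, map_zero]
  · rw [Module.End.mul_apply, E_apply_eq_zero_of_neg_zero₄₅ t hJe hJf hJ hm hH, map_zero]
  · rw [Module.End.mul_apply, (FE_apply_of_neg_one₄₅ t hJf hJ hm hH).2]

/-- **`E H = -E`.** [cite: Bourbaki2008LieGroups79, Ch. VIII §1 no. 2 Prop. 1 (2) and no. 3 Thm. 1] [cite: MoonenZarhin1999LowDim, §3 Lemma (3.4)] -/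
theorem IsSl2Triple.toEnd_e_mul_toEnd_h_of_sq_eq_neg_one (t : IsSl2Triple h e f)
    (hJh : J₁ * toEnd ℂ L M h = toEnd ℂ L M h * J₁) (hJe : J₁ * toEnd ℂ L M e = toEnd ℂ L M e * J₁)
    (hJf : J₁ * toEnd ℂ L M f = toEnd ℂ L M f * J₁)
    (hJ : (J₁ + Complex.I • toEnd ℂ L M h) * (J₁ + Complex.I • toEnd ℂ L M h) = -1) :
    toEnd ℂ L M e * toEnd ℂ L M h = -toEnd ℂ L M e := by
  refine ext_of_pieces₄₅ t hJh hJe hJf hJ (fun m hm hH ↦ ?_) (fun m hm hH ↦ ?_) (fun m hm hH ↦ ?_) (fun m hm hH ↦ ?_)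
  · rw [Module.End.mul_apply, hH, map_zero, LinearMap.neg_apply, E_apply_eq_zero_of_pos₄₅ t hJe hJ hm, neg_zero]
  · rw [Module.End.mul_apply, hH, LinearMap.neg_apply, E_apply_eq_zero_of_pos₄₅ t hJe hJ hm, neg_zero]
  · rw [Module.End.mul_apply, hH, map_zero, LinearMap.neg_apply, E_apply_eq_zero_of_neg_zero₄₅ t hJe hJf hJ hm hH, neg_zero]
  · rw [Module.End.mul_apply, hH, map_neg, LinearMap.neg_apply]

/-- **`H F = -F`.** [cite: Bourbaki2008LieGroups79, Ch. VIII §1 no. 2 Prop. 1 (2) and no. 3 Thm. 1] [cite: MoonenZarhin1999LowDim, §3 Lemma (3.4)] -/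
theorem IsSl2Triple.toEnd_h_mul_toEnd_f_of_sq_eq_neg_one (t : IsSl2Triple h e f)
    (hJh : J₁ * toEnd ℂ L M h = toEnd ℂ L M h * J₁) (hJe : J₁ * toEnd ℂ L M e = toEnd ℂ L M e * J₁)
    (hJf : J₁ * toEnd ℂ L M f = toEnd ℂ L M f * J₁)
    (hJ : (J₁ + Complex.I • toEnd ℂ L M h) * (J₁ + Complex.I • toEnd ℂ L M h) = -1) :
    toEnd ℂ L M h * toEnd ℂ L M f = -toEnd ℂ L M f := by
  refine ext_of_pieces₄₅ t hJh hJe hJf hJ (fun m hm hH ↦ ?_) (fun m hm hH ↦ ?_) (fun m hm _ ↦ ?_) (fun m hm _ ↦ ?_)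
  · rw [Module.End.mul_apply, LinearMap.neg_apply, F_apply_eq_zero_of_pos_zero₄₅ t hJe hJf hJ hm hH, map_zero, neg_zero]
  · rw [Module.End.mul_apply, LinearMap.neg_apply, (EF_apply_of_pos_one₄₅ t hJe hJ hm hH).2]
  · rw [Module.End.mul_apply, LinearMap.neg_apply, F_apply_eq_zero_of_neg₄₅ t hJf hJ hm, map_zero, neg_zero]
  · rw [Module.End.mul_apply, LinearMap.neg_apply, F_apply_eq_zero_of_neg₄₅ t hJf hJ hm, map_zero, neg_zero]

/-- **`F H = F`.** [cite: Bourbaki2008LieGroups79, Ch. VIII §1 no. 2 Prop. 1 (2) and no. 3 Thm. 1] [cite: MoonenZarhin1999LowDim, §3 Lemma (3.4)] -/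
theorem IsSl2Triple.toEnd_f_mul_toEnd_h_of_sq_eq_neg_one (t : IsSl2Triple h e f)
    (hJh : J₁ * toEnd ℂ L M h = toEnd ℂ L M h * J₁) (hJe : J₁ * toEnd ℂ L M e = toEnd ℂ L M e * J₁)
    (hJf : J₁ * toEnd ℂ L M f = toEnd ℂ L M f * J₁)
    (hJ : (J₁ + Complex.I • toEnd ℂ L M h) * (J₁ + Complex.I • toEnd ℂ L M h) = -1) :
    toEnd ℂ L M f * toEnd ℂ L M h = toEnd ℂ L M f := by
  refine ext_of_pieces₄₅ t hJh hJe hJf hJ (fun m hm hH ↦ ?_) (fun m hm hH ↦ ?_) (fun m hm hH ↦ ?_) (fun m hm hH ↦ ?_)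
  · rw [Module.End.mul_apply, hH, map_zero, F_apply_eq_zero_of_pos_zero₄₅ t hJe hJf hJ hm hH]
  · rw [Module.End.mul_apply, hH]
  · rw [Module.End.mul_apply, hH, map_zero, F_apply_eq_zero_of_neg₄₅ t hJf hJ hm]
  · rw [Module.End.mul_apply, hH, map_neg, F_apply_eq_zero_of_neg₄₅ t hJf hJ hm, neg_zero]

/-- **`E F + F E = H²`** (`E F`, `F E` are the two weight projectors on `Im H`, and vanish on `Ker H`).
[cite: Bourbaki2008LieGroups79, Ch. VIII §1 no. 2 Prop. 1 (2) and no. 3 Thm. 1] [cite: MoonenZarhin1999LowDim, §3 Lemma (3.4)] -/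
theorem IsSl2Triple.toEnd_e_mul_toEnd_f_add_of_sq_eq_neg_one (t : IsSl2Triple h e f)
    (hJh : J₁ * toEnd ℂ L M h = toEnd ℂ L M h * J₁) (hJe : J₁ * toEnd ℂ L M e = toEnd ℂ L M e * J₁)
    (hJf : J₁ * toEnd ℂ L M f = toEnd ℂ L M f * J₁)
    (hJ : (J₁ + Complex.I • toEnd ℂ L M h) * (J₁ + Complex.I • toEnd ℂ L M h) = -1) :
    toEnd ℂ L M e * toEnd ℂ L M f + toEnd ℂ L M f * toEnd ℂ L M e = toEnd ℂ L M h * toEnd ℂ L M h := by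
  refine ext_of_pieces₄₅ t hJh hJe hJf hJ (fun m hm hH ↦ ?_) (fun m hm hH ↦ ?_) (fun m hm hH ↦ ?_) (fun m hm hH ↦ ?_)
  · rw [LinearMap.add_apply, Module.End.mul_apply, Module.End.mul_apply, Module.End.mul_apply, hH, map_zero,
      E_apply_eq_zero_of_pos₄₅ t hJe hJ hm, map_zero, F_apply_eq_zero_of_pos_zero₄₅ t hJe hJf hJ hm hH, map_zero, add_zero]
  · rw [LinearMap.add_apply, Module.End.mul_apply, Module.End.mul_apply, Module.End.mul_apply, hH, hH,
      E_apply_eq_zero_of_pos₄₅ t hJe hJ hm, map_zero, add_zero, (EF_apply_of_pos_one₄₅ t hJe hJ hm hH).1]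
  · rw [LinearMap.add_apply, Module.End.mul_apply, Module.End.mul_apply, Module.End.mul_apply, hH, map_zero,
      F_apply_eq_zero_of_neg₄₅ t hJf hJ hm, map_zero, E_apply_eq_zero_of_neg_zero₄₅ t hJe hJf hJ hm hH, map_zero, add_zero]
  · rw [LinearMap.add_apply, Module.End.mul_apply, Module.End.mul_apply, Module.End.mul_apply, hH, map_neg, hH, neg_neg,
      F_apply_eq_zero_of_neg₄₅ t hJf hJ hm, map_zero, zero_add, (FE_apply_of_neg_one₄₅ t hJf hJ hm hH).1]

/-- **Every element of `ℂ H + ℂ E + ℂ F` squares to a multiple of `H²`: `(a H + b E + c F)² = (a² + b c) H²`** — the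
`𝔰𝔩₂`-image acts through copies of the standard representation on `Im H` (where `Y² = -det(Y) · 1` for traceless
`2 × 2` matrices `Y`) and by `0` on `Ker H`. [cite: MoonenZarhin1999LowDim, §2 (2.2)–(2.3) and §3 Lemma (3.4)]
[cite: Bourbaki2008LieGroups79, Ch. VIII §1 no. 3 Thm. 1] -/
theorem IsSl2Triple.smul_add_mul_self_eq_of_sq_eq_neg_one (t : IsSl2Triple h e f)
    (hJh : J₁ * toEnd ℂ L M h = toEnd ℂ L M h * J₁) (hJe : J₁ * toEnd ℂ L M e = toEnd ℂ L M e * J₁)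
    (hJf : J₁ * toEnd ℂ L M f = toEnd ℂ L M f * J₁)
    (hJ : (J₁ + Complex.I • toEnd ℂ L M h) * (J₁ + Complex.I • toEnd ℂ L M h) = -1) (a b c : ℂ) :
    (a • toEnd ℂ L M h + b • toEnd ℂ L M e + c • toEnd ℂ L M f) * (a • toEnd ℂ L M h + b • toEnd ℂ L M e + c • toEnd ℂ L M f) =
      (a ^ 2 + b * c) • (toEnd ℂ L M h * toEnd ℂ L M h) := by
  have hEE := IsSl2Triple.toEnd_e_mul_toEnd_e_eq_zero_of_sq_eq_neg_one t hJe hJ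
  have hFF := IsSl2Triple.toEnd_f_mul_toEnd_f_eq_zero_of_sq_eq_neg_one t hJf hJ
  have hHE := IsSl2Triple.toEnd_h_mul_toEnd_e_of_sq_eq_neg_one t hJh hJe hJf hJ
  have hEH := IsSl2Triple.toEnd_e_mul_toEnd_h_of_sq_eq_neg_one t hJh hJe hJf hJ
  have hHF := IsSl2Triple.toEnd_h_mul_toEnd_f_of_sq_eq_neg_one t hJh hJe hJf hJ
  have hFH := IsSl2Triple.toEnd_f_mul_toEnd_h_of_sq_eq_neg_one t hJh hJe hJf hJ
  have hEF : toEnd ℂ L M e * toEnd ℂ L M f = toEnd ℂ L M h * toEnd ℂ L M h - toEnd ℂ L M f * toEnd ℂ L M e :=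
    eq_sub_of_add_eq (IsSl2Triple.toEnd_e_mul_toEnd_f_add_of_sq_eq_neg_one t hJh hJe hJf hJ)
  simp only [add_mul, mul_add, smul_mul_assoc, mul_smul_comm, hEE, hFF, hHE, hEH, hHF, hFH, hEF]
  module

/-- `s H² = s` for `s ∈ ℂ H + ℂ E + ℂ F` (`H²` is the projector onto `Im H ⊇ Im E, Im F`).
[cite: Bourbaki2008LieGroups79, Ch. VIII §1 no. 3 Thm. 1] [cite: MoonenZarhin1999LowDim, §3 Lemma (3.4)] -/
theorem IsSl2Triple.smul_add_mul_toEnd_h_mul_toEnd_h_of_sq_eq_neg_one (t : IsSl2Triple h e f)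
    (hJh : J₁ * toEnd ℂ L M h = toEnd ℂ L M h * J₁) (hJe : J₁ * toEnd ℂ L M e = toEnd ℂ L M e * J₁)
    (hJf : J₁ * toEnd ℂ L M f = toEnd ℂ L M f * J₁)
    (hJ : (J₁ + Complex.I • toEnd ℂ L M h) * (J₁ + Complex.I • toEnd ℂ L M h) = -1) (a b c : ℂ) :
    (a • toEnd ℂ L M h + b • toEnd ℂ L M e + c • toEnd ℂ L M f) * (toEnd ℂ L M h * toEnd ℂ L M h) =
      a • toEnd ℂ L M h + b • toEnd ℂ L M e + c • toEnd ℂ L M f := by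
  have hHHH := IsSl2Triple.toEnd_h_mul_self_mul_self_of_sq_eq_neg_one t hJh hJe hJf hJ
  have hEH := IsSl2Triple.toEnd_e_mul_toEnd_h_of_sq_eq_neg_one t hJh hJe hJf hJ
  have hFH := IsSl2Triple.toEnd_f_mul_toEnd_h_of_sq_eq_neg_one t hJh hJe hJf hJ
  rw [add_mul, add_mul, smul_mul_assoc, smul_mul_assoc, smul_mul_assoc, ← mul_assoc, ← mul_assoc, ← mul_assoc, hHHH,
    hEH, neg_mul, hEH, neg_neg, hFH, hFH]

/-- `H² s = s` for `s ∈ ℂ H + ℂ E + ℂ F`. [cite: Bourbaki2008LieGroups79, Ch. VIII §1 no. 3 Thm. 1] [cite: MoonenZarhin1999LowDim, §3 Lemma (3.4)] -/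
theorem IsSl2Triple.toEnd_h_mul_toEnd_h_mul_smul_add_of_sq_eq_neg_one (t : IsSl2Triple h e f)
    (hJh : J₁ * toEnd ℂ L M h = toEnd ℂ L M h * J₁) (hJe : J₁ * toEnd ℂ L M e = toEnd ℂ L M e * J₁)
    (hJf : J₁ * toEnd ℂ L M f = toEnd ℂ L M f * J₁)
    (hJ : (J₁ + Complex.I • toEnd ℂ L M h) * (J₁ + Complex.I • toEnd ℂ L M h) = -1) (a b c : ℂ) :
    toEnd ℂ L M h * toEnd ℂ L M h * (a • toEnd ℂ L M h + b • toEnd ℂ L M e + c • toEnd ℂ L M f) =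
      a • toEnd ℂ L M h + b • toEnd ℂ L M e + c • toEnd ℂ L M f := by
  have hHHH := IsSl2Triple.toEnd_h_mul_self_mul_self_of_sq_eq_neg_one t hJh hJe hJf hJ
  have hHE := IsSl2Triple.toEnd_h_mul_toEnd_e_of_sq_eq_neg_one t hJh hJe hJf hJ
  have hHF := IsSl2Triple.toEnd_h_mul_toEnd_f_of_sq_eq_neg_one t hJh hJe hJf hJ
  rw [mul_add, mul_add, mul_smul_comm, mul_smul_comm, mul_smul_comm, hHHH, mul_assoc, hHE, hHE, mul_assoc, hHF, mul_neg,
    hHF, neg_neg]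

/-- `J₁ s = 0` for `s ∈ ℂ H + ℂ E + ℂ F` (`J₁ H = 0`, `E = H E`, `F = -H F`). [cite: MoonenZarhin1999LowDim, §3 Lemma (3.4) (proof)] -/
theorem IsSl2Triple.mul_smul_add_eq_zero_of_sq_eq_neg_one (t : IsSl2Triple h e f)
    (hJh : J₁ * toEnd ℂ L M h = toEnd ℂ L M h * J₁) (hJe : J₁ * toEnd ℂ L M e = toEnd ℂ L M e * J₁)
    (hJf : J₁ * toEnd ℂ L M f = toEnd ℂ L M f * J₁)
    (hJ : (J₁ + Complex.I • toEnd ℂ L M h) * (J₁ + Complex.I • toEnd ℂ L M h) = -1) (a b c : ℂ) :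
    J₁ * (a • toEnd ℂ L M h + b • toEnd ℂ L M e + c • toEnd ℂ L M f) = 0 := by
  have hJH := IsSl2Triple.mul_toEnd_h_eq_zero_of_sq_eq_neg_one t hJh hJe hJf hJ
  have hHE := IsSl2Triple.toEnd_h_mul_toEnd_e_of_sq_eq_neg_one t hJh hJe hJf hJ
  have hHF := IsSl2Triple.toEnd_h_mul_toEnd_f_of_sq_eq_neg_one t hJh hJe hJf hJ
  have hJE : J₁ * toEnd ℂ L M e = 0 := by rw [← hHE, ← mul_assoc, hJH, zero_mul]
  have hJF : J₁ * toEnd ℂ L M f = 0 := by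
    rw [← neg_neg (toEnd ℂ L M f), ← hHF, mul_neg, ← mul_assoc, hJH, zero_mul, neg_zero]
  rw [mul_add, mul_add, mul_smul_comm, mul_smul_comm, mul_smul_comm, hJH, hJE, hJF, smul_zero, smul_zero, smul_zero,
    add_zero, add_zero]

/-- `s J₁ = 0` for `s ∈ ℂ H + ℂ E + ℂ F`. [cite: MoonenZarhin1999LowDim, §3 Lemma (3.4) (proof)] -/
theorem IsSl2Triple.smul_add_mul_eq_zero_of_sq_eq_neg_one (t : IsSl2Triple h e f)
    (hJh : J₁ * toEnd ℂ L M h = toEnd ℂ L M h * J₁) (hJe : J₁ * toEnd ℂ L M e = toEnd ℂ L M e * J₁)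
    (hJf : J₁ * toEnd ℂ L M f = toEnd ℂ L M f * J₁)
    (hJ : (J₁ + Complex.I • toEnd ℂ L M h) * (J₁ + Complex.I • toEnd ℂ L M h) = -1) (a b c : ℂ) :
    (a • toEnd ℂ L M h + b • toEnd ℂ L M e + c • toEnd ℂ L M f) * J₁ = 0 := by
  have h1 := IsSl2Triple.mul_smul_add_eq_zero_of_sq_eq_neg_one t hJh hJe hJf hJ a b c
  rw [mul_add, mul_add, mul_smul_comm, mul_smul_comm, mul_smul_comm, hJh, hJe, hJf] at h1
  rw [add_mul, add_mul, smul_mul_assoc, smul_mul_assoc, smul_mul_assoc, h1]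

end ComplexStructure

/-! ### §5 Matrix form: an `𝔰𝔩₂`-triple of complex matrices next to a commuting complex structure -/

section MatrixForm

variable {n : Type u} [Fintype n] [DecidableEq n] {h e f J₁ : Matrix n n ℂ}

/-- The transfer package: all identities of §1–§4 for an `𝔰𝔩₂`-triple `(h, e, f)` of MATRICES (`[h,e] = 2e`, `[h,f] = -2f`,
`[e,f] = h`, `h ≠ 0`) and a matrix `J₁` commuting with it such that `(J₁ + i h)² = -1`, via `L = End(ℂⁿ)`, `M = ℂⁿ`.
[cite: MoonenZarhin1999LowDim, §3 Lemma (3.4) (proof)] [cite: Bourbaki2008LieGroups79, Ch. VIII §1 no. 2 Cor. (i)–(ii) of Prop. 2] -/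
private theorem matrixPack₄₅ (h0 : h ≠ 0) (rhe : h * e - e * h = (2 : ℂ) • e) (rhf : h * f - f * h = -((2 : ℂ) • f))
    (ref : e * f - f * e = h) (cJh : J₁ * h = h * J₁) (cJe : J₁ * e = e * J₁) (cJf : J₁ * f = f * J₁)
    (hJ : (J₁ + Complex.I • h) * (J₁ + Complex.I • h) = -1) :
    e * e = 0 ∧ f * f = 0 ∧ J₁ * h = 0 ∧ h * h * h = h ∧ h * e = e ∧ e * h = -e ∧ h * f = -f ∧ f * h = f ∧
      e * f + f * e = h * h ∧ ∀ μ : ℂ, Module.End.HasEigenvalue (Matrix.toLin' h) μ → μ = -1 ∨ μ = 0 ∨ μ = 1 := by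
  letI : LieRing (Module.End ℂ (n → ℂ)) := LieRing.ofAssociativeRing
  letI : LieAlgebra ℂ (Module.End ℂ (n → ℂ)) := LieAlgebra.ofAssociativeAlgebra
  set φ := Matrix.toLinAlgEquiv' (R := ℂ) (n := n) with hφ
  have hρ : ∀ T : Module.End ℂ (n → ℂ), toEnd ℂ (Module.End ℂ (n → ℂ)) (n → ℂ) T = T :=
    fun T ↦ LinearMap.ext fun m ↦ by simp
  have t : IsSl2Triple (φ h) (φ e) (φ f) := by
    refine ⟨(map_ne_zero_iff φ φ.injective).2 h0, ?_, ?_, ?_⟩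
    · rw [Ring.lie_def, ← map_mul, ← map_mul, ← map_sub, ref]
    · rw [Ring.lie_def, ← map_mul, ← map_mul, ← map_sub, rhe, map_smul, two_smul, two_smul]
    · rw [Ring.lie_def, ← map_mul, ← map_mul, ← map_sub, rhf, map_neg, map_smul, two_smul, two_smul]
  have cJh' : φ J₁ * toEnd ℂ _ (n → ℂ) (φ h) = toEnd ℂ _ (n → ℂ) (φ h) * φ J₁ := by
    rw [hρ, ← map_mul, cJh, map_mul]
  have cJe' : φ J₁ * toEnd ℂ _ (n → ℂ) (φ e) = toEnd ℂ _ (n → ℂ) (φ e) * φ J₁ := by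
    rw [hρ, ← map_mul, cJe, map_mul]
  have cJf' : φ J₁ * toEnd ℂ _ (n → ℂ) (φ f) = toEnd ℂ _ (n → ℂ) (φ f) * φ J₁ := by
    rw [hρ, ← map_mul, cJf, map_mul]
  have hJ' : (φ J₁ + Complex.I • toEnd ℂ _ (n → ℂ) (φ h)) * (φ J₁ + Complex.I • toEnd ℂ _ (n → ℂ) (φ h)) = -1 := by
    rw [hρ, ← map_smul, ← map_add, ← map_mul, hJ, map_neg, map_one]
  have tr : ∀ {A B : Matrix n n ℂ}, φ A = φ B → A = B := fun hAB ↦ φ.injective hAB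
  refine ⟨?_, ?_, ?_, ?_, ?_, ?_, ?_, ?_, ?_, fun μ hμ ↦ ?_⟩
  · have h1 := IsSl2Triple.toEnd_e_mul_toEnd_e_eq_zero_of_sq_eq_neg_one t cJe' hJ'
    rw [hρ] at h1
    exact tr (by rw [map_mul, map_zero, h1])
  · have h1 := IsSl2Triple.toEnd_f_mul_toEnd_f_eq_zero_of_sq_eq_neg_one t cJf' hJ'
    rw [hρ] at h1
    exact tr (by rw [map_mul, map_zero, h1])
  · have h1 := IsSl2Triple.mul_toEnd_h_eq_zero_of_sq_eq_neg_one t cJh' cJe' cJf' hJ'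
    rw [hρ] at h1
    exact tr (by rw [map_mul, map_zero, h1])
  · have h1 := IsSl2Triple.toEnd_h_mul_self_mul_self_of_sq_eq_neg_one t cJh' cJe' cJf' hJ'
    rw [hρ] at h1
    exact tr (by rw [map_mul, map_mul, h1])
  · have h1 := IsSl2Triple.toEnd_h_mul_toEnd_e_of_sq_eq_neg_one t cJh' cJe' cJf' hJ'
    rw [hρ, hρ] at h1
    exact tr (by rw [map_mul, h1])
  · have h1 := IsSl2Triple.toEnd_e_mul_toEnd_h_of_sq_eq_neg_one t cJh' cJe' cJf' hJ'
    rw [hρ, hρ] at h1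
    exact tr (by rw [map_mul, map_neg, h1])
  · have h1 := IsSl2Triple.toEnd_h_mul_toEnd_f_of_sq_eq_neg_one t cJh' cJe' cJf' hJ'
    rw [hρ, hρ] at h1
    exact tr (by rw [map_mul, map_neg, h1])
  · have h1 := IsSl2Triple.toEnd_f_mul_toEnd_h_of_sq_eq_neg_one t cJh' cJe' cJf' hJ'
    rw [hρ, hρ] at h1
    exact tr (by rw [map_mul, h1])
  · have h1 := IsSl2Triple.toEnd_e_mul_toEnd_f_add_of_sq_eq_neg_one t cJh' cJe' cJf' hJ'
    rw [hρ, hρ, hρ] at h1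
    exact tr (by rw [map_add, map_mul, map_mul, map_mul, h1])
  · have h1 := IsSl2Triple.eq_of_hasEigenvalue_toEnd_h_of_sq_eq_neg_one t cJh' cJe' cJf' hJ' (μ := μ)
    rw [hρ] at h1
    exact h1 hμ

/-- **Matrix form, `E² = 0`**: for an `𝔰𝔩₂`-triple `(h, e, f)` in `M_n(ℂ)` and `J₁` commuting with it with
`(J₁ + i h)² = -1`, `e² = 0`. [cite: MoonenZarhin1999LowDim, §3 Lemma (3.4) (proof)] [cite: Bourbaki2008LieGroups79, Ch. VIII §1 no. 2 Cor. (ii) of Prop. 2] -/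
theorem sl2Matrix_e_mul_e_eq_zero_of_sq_eq_neg_one (h0 : h ≠ 0) (rhe : h * e - e * h = (2 : ℂ) • e)
    (rhf : h * f - f * h = -((2 : ℂ) • f)) (ref : e * f - f * e = h) (cJh : J₁ * h = h * J₁) (cJe : J₁ * e = e * J₁)
    (cJf : J₁ * f = f * J₁) (hJ : (J₁ + Complex.I • h) * (J₁ + Complex.I • h) = -1) : e * e = 0 :=
  (matrixPack₄₅ h0 rhe rhf ref cJh cJe cJf hJ).1

/-- **Matrix form, `F² = 0`.** [cite: MoonenZarhin1999LowDim, §3 Lemma (3.4) (proof)] [cite: Bourbaki2008LieGroups79, Ch. VIII §1 no. 2 Cor. (ii) of Prop. 2] -/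
theorem sl2Matrix_f_mul_f_eq_zero_of_sq_eq_neg_one (h0 : h ≠ 0) (rhe : h * e - e * h = (2 : ℂ) • e)
    (rhf : h * f - f * h = -((2 : ℂ) • f)) (ref : e * f - f * e = h) (cJh : J₁ * h = h * J₁) (cJe : J₁ * e = e * J₁)
    (cJf : J₁ * f = f * J₁) (hJ : (J₁ + Complex.I • h) * (J₁ + Complex.I • h) = -1) : f * f = 0 :=
  (matrixPack₄₅ h0 rhe rhf ref cJh cJe cJf hJ).2.1

/-- **Matrix form, «`J₂` acts trivially»: `J₁ h = 0`.** [cite: MoonenZarhin1999LowDim, §3 Lemma (3.4) (proof)] -/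
theorem sl2Matrix_mul_h_eq_zero_of_sq_eq_neg_one (h0 : h ≠ 0) (rhe : h * e - e * h = (2 : ℂ) • e)
    (rhf : h * f - f * h = -((2 : ℂ) • f)) (ref : e * f - f * e = h) (cJh : J₁ * h = h * J₁) (cJe : J₁ * e = e * J₁)
    (cJf : J₁ * f = f * J₁) (hJ : (J₁ + Complex.I • h) * (J₁ + Complex.I • h) = -1) : J₁ * h = 0 :=
  (matrixPack₄₅ h0 rhe rhf ref cJh cJe cJf hJ).2.2.1

/-- **Matrix form, `h³ = h`.** [cite: MoonenZarhin1999LowDim, §2 (2.2)–(2.3) and §3 Lemma (3.4)]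
[cite: Bourbaki2008LieGroups79, Ch. VIII §1 no. 2 Cor. (i)–(ii) of Prop. 2] -/
theorem sl2Matrix_h_mul_h_mul_h_of_sq_eq_neg_one (h0 : h ≠ 0) (rhe : h * e - e * h = (2 : ℂ) • e)
    (rhf : h * f - f * h = -((2 : ℂ) • f)) (ref : e * f - f * e = h) (cJh : J₁ * h = h * J₁) (cJe : J₁ * e = e * J₁)
    (cJf : J₁ * f = f * J₁) (hJ : (J₁ + Complex.I • h) * (J₁ + Complex.I • h) = -1) : h * h * h = h :=
  (matrixPack₄₅ h0 rhe rhf ref cJh cJe cJf hJ).2.2.2.1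

/-- **Matrix form, `h e = e`.** [cite: Bourbaki2008LieGroups79, Ch. VIII §1 no. 3 Thm. 1] [cite: MoonenZarhin1999LowDim, §3 Lemma (3.4)] -/
theorem sl2Matrix_h_mul_e_of_sq_eq_neg_one (h0 : h ≠ 0) (rhe : h * e - e * h = (2 : ℂ) • e)
    (rhf : h * f - f * h = -((2 : ℂ) • f)) (ref : e * f - f * e = h) (cJh : J₁ * h = h * J₁) (cJe : J₁ * e = e * J₁)
    (cJf : J₁ * f = f * J₁) (hJ : (J₁ + Complex.I • h) * (J₁ + Complex.I • h) = -1) : h * e = e :=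
  (matrixPack₄₅ h0 rhe rhf ref cJh cJe cJf hJ).2.2.2.2.1

/-- **Matrix form, `e h = -e`.** [cite: Bourbaki2008LieGroups79, Ch. VIII §1 no. 3 Thm. 1] [cite: MoonenZarhin1999LowDim, §3 Lemma (3.4)] -/
theorem sl2Matrix_e_mul_h_of_sq_eq_neg_one (h0 : h ≠ 0) (rhe : h * e - e * h = (2 : ℂ) • e)
    (rhf : h * f - f * h = -((2 : ℂ) • f)) (ref : e * f - f * e = h) (cJh : J₁ * h = h * J₁) (cJe : J₁ * e = e * J₁)
    (cJf : J₁ * f = f * J₁) (hJ : (J₁ + Complex.I • h) * (J₁ + Complex.I • h) = -1) : e * h = -e :=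
  (matrixPack₄₅ h0 rhe rhf ref cJh cJe cJf hJ).2.2.2.2.2.1

/-- **Matrix form, `h f = -f`.** [cite: Bourbaki2008LieGroups79, Ch. VIII §1 no. 3 Thm. 1] [cite: MoonenZarhin1999LowDim, §3 Lemma (3.4)] -/
theorem sl2Matrix_h_mul_f_of_sq_eq_neg_one (h0 : h ≠ 0) (rhe : h * e - e * h = (2 : ℂ) • e)
    (rhf : h * f - f * h = -((2 : ℂ) • f)) (ref : e * f - f * e = h) (cJh : J₁ * h = h * J₁) (cJe : J₁ * e = e * J₁)
    (cJf : J₁ * f = f * J₁) (hJ : (J₁ + Complex.I • h) * (J₁ + Complex.I • h) = -1) : h * f = -f :=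
  (matrixPack₄₅ h0 rhe rhf ref cJh cJe cJf hJ).2.2.2.2.2.2.1

/-- **Matrix form, `f h = f`.** [cite: Bourbaki2008LieGroups79, Ch. VIII §1 no. 3 Thm. 1] [cite: MoonenZarhin1999LowDim, §3 Lemma (3.4)] -/
theorem sl2Matrix_f_mul_h_of_sq_eq_neg_one (h0 : h ≠ 0) (rhe : h * e - e * h = (2 : ℂ) • e)
    (rhf : h * f - f * h = -((2 : ℂ) • f)) (ref : e * f - f * e = h) (cJh : J₁ * h = h * J₁) (cJe : J₁ * e = e * J₁)
    (cJf : J₁ * f = f * J₁) (hJ : (J₁ + Complex.I • h) * (J₁ + Complex.I • h) = -1) : f * h = f :=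
  (matrixPack₄₅ h0 rhe rhf ref cJh cJe cJf hJ).2.2.2.2.2.2.2.1

/-- **Matrix form, `e f + f e = h²`.** [cite: Bourbaki2008LieGroups79, Ch. VIII §1 no. 3 Thm. 1] [cite: MoonenZarhin1999LowDim, §3 Lemma (3.4)] -/
theorem sl2Matrix_e_mul_f_add_of_sq_eq_neg_one (h0 : h ≠ 0) (rhe : h * e - e * h = (2 : ℂ) • e)
    (rhf : h * f - f * h = -((2 : ℂ) • f)) (ref : e * f - f * e = h) (cJh : J₁ * h = h * J₁) (cJe : J₁ * e = e * J₁)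
    (cJf : J₁ * f = f * J₁) (hJ : (J₁ + Complex.I • h) * (J₁ + Complex.I • h) = -1) : e * f + f * e = h * h :=
  (matrixPack₄₅ h0 rhe rhf ref cJh cJe cJf hJ).2.2.2.2.2.2.2.2.1

/-- **Matrix form, the weights of `h` are `-1, 0, 1`.** [cite: MoonenZarhin1999LowDim, §2 (2.2)–(2.3) and §3 Lemma (3.4)]
[cite: Bourbaki2008LieGroups79, Ch. VIII §1 no. 2 Cor. (i)–(ii) of Prop. 2] -/
theorem sl2Matrix_eq_of_hasEigenvalue_of_sq_eq_neg_one (h0 : h ≠ 0) (rhe : h * e - e * h = (2 : ℂ) • e)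
    (rhf : h * f - f * h = -((2 : ℂ) • f)) (ref : e * f - f * e = h) (cJh : J₁ * h = h * J₁) (cJe : J₁ * e = e * J₁)
    (cJf : J₁ * f = f * J₁) (hJ : (J₁ + Complex.I • h) * (J₁ + Complex.I • h) = -1) {μ : ℂ}
    (hμ : Module.End.HasEigenvalue (Matrix.toLin' h) μ) : μ = -1 ∨ μ = 0 ∨ μ = 1 :=
  (matrixPack₄₅ h0 rhe rhf ref cJh cJe cJf hJ).2.2.2.2.2.2.2.2.2 μ hμ

/-- **Matrix form, `(a h + b e + c f)² = (a² + b c) h²`.** [cite: MoonenZarhin1999LowDim, §2 (2.2)–(2.3) and §3 Lemma (3.4)]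
[cite: Bourbaki2008LieGroups79, Ch. VIII §1 no. 3 Thm. 1] -/
theorem sl2Matrix_smul_add_mul_self_eq_of_sq_eq_neg_one (h0 : h ≠ 0) (rhe : h * e - e * h = (2 : ℂ) • e)
    (rhf : h * f - f * h = -((2 : ℂ) • f)) (ref : e * f - f * e = h) (cJh : J₁ * h = h * J₁) (cJe : J₁ * e = e * J₁)
    (cJf : J₁ * f = f * J₁) (hJ : (J₁ + Complex.I • h) * (J₁ + Complex.I • h) = -1) (a b c : ℂ) :
    (a • h + b • e + c • f) * (a • h + b • e + c • f) = (a ^ 2 + b * c) • (h * h) := by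
  obtain ⟨hEE, hFF, -, -, hHE, hEH, hHF, hFH, hEFFE, -⟩ := matrixPack₄₅ h0 rhe rhf ref cJh cJe cJf hJ
  have hEF : e * f = h * h - f * e := eq_sub_of_add_eq hEFFE
  simp only [add_mul, mul_add, smul_mul_assoc, mul_smul_comm, hEE, hFF, hHE, hEH, hHF, hFH, hEF]
  module

/-- Matrix form, `s h² = s` for `s = a h + b e + c f`. [cite: Bourbaki2008LieGroups79, Ch. VIII §1 no. 3 Thm. 1] [cite: MoonenZarhin1999LowDim, §3 Lemma (3.4)] -/
theorem sl2Matrix_smul_add_mul_h_mul_h_of_sq_eq_neg_one (h0 : h ≠ 0) (rhe : h * e - e * h = (2 : ℂ) • e)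
    (rhf : h * f - f * h = -((2 : ℂ) • f)) (ref : e * f - f * e = h) (cJh : J₁ * h = h * J₁) (cJe : J₁ * e = e * J₁)
    (cJf : J₁ * f = f * J₁) (hJ : (J₁ + Complex.I • h) * (J₁ + Complex.I • h) = -1) (a b c : ℂ) :
    (a • h + b • e + c • f) * (h * h) = a • h + b • e + c • f := by
  obtain ⟨-, -, -, hHHH, -, hEH, -, hFH, -, -⟩ := matrixPack₄₅ h0 rhe rhf ref cJh cJe cJf hJ
  rw [add_mul, add_mul, smul_mul_assoc, smul_mul_assoc, smul_mul_assoc, ← mul_assoc, ← mul_assoc, ← mul_assoc, hHHH,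
    hEH, neg_mul, hEH, neg_neg, hFH, hFH]

/-- Matrix form, `h² s = s` for `s = a h + b e + c f`. [cite: Bourbaki2008LieGroups79, Ch. VIII §1 no. 3 Thm. 1] [cite: MoonenZarhin1999LowDim, §3 Lemma (3.4)] -/
theorem sl2Matrix_h_mul_h_mul_smul_add_of_sq_eq_neg_one (h0 : h ≠ 0) (rhe : h * e - e * h = (2 : ℂ) • e)
    (rhf : h * f - f * h = -((2 : ℂ) • f)) (ref : e * f - f * e = h) (cJh : J₁ * h = h * J₁) (cJe : J₁ * e = e * J₁)
    (cJf : J₁ * f = f * J₁) (hJ : (J₁ + Complex.I • h) * (J₁ + Complex.I • h) = -1) (a b c : ℂ) :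
    h * h * (a • h + b • e + c • f) = a • h + b • e + c • f := by
  obtain ⟨-, -, -, hHHH, hHE, -, hHF, -, -, -⟩ := matrixPack₄₅ h0 rhe rhf ref cJh cJe cJf hJ
  rw [mul_add, mul_add, mul_smul_comm, mul_smul_comm, mul_smul_comm, hHHH, mul_assoc, hHE, hHE, mul_assoc, hHF, mul_neg,
    hHF, neg_neg]

/-- Matrix form, `J₁ s = 0` for `s = a h + b e + c f`. [cite: MoonenZarhin1999LowDim, §3 Lemma (3.4) (proof)] -/
theorem sl2Matrix_mul_smul_add_eq_zero_of_sq_eq_neg_one (h0 : h ≠ 0) (rhe : h * e - e * h = (2 : ℂ) • e)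
    (rhf : h * f - f * h = -((2 : ℂ) • f)) (ref : e * f - f * e = h) (cJh : J₁ * h = h * J₁) (cJe : J₁ * e = e * J₁)
    (cJf : J₁ * f = f * J₁) (hJ : (J₁ + Complex.I • h) * (J₁ + Complex.I • h) = -1) (a b c : ℂ) :
    J₁ * (a • h + b • e + c • f) = 0 := by
  obtain ⟨-, -, hJH, -, hHE, -, hHF, -, -, -⟩ := matrixPack₄₅ h0 rhe rhf ref cJh cJe cJf hJ
  have hJE : J₁ * e = 0 := by rw [← hHE, ← mul_assoc, hJH, zero_mul]
  have hJF : J₁ * f = 0 := by rw [← neg_neg f, ← hHF, mul_neg, ← mul_assoc, hJH, zero_mul, neg_zero]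
  rw [mul_add, mul_add, mul_smul_comm, mul_smul_comm, mul_smul_comm, hJH, hJE, hJF, smul_zero, smul_zero, smul_zero,
    add_zero, add_zero]

/-- Matrix form, `s J₁ = 0` for `s = a h + b e + c f`. [cite: MoonenZarhin1999LowDim, §3 Lemma (3.4) (proof)] -/
theorem sl2Matrix_smul_add_mul_eq_zero_of_sq_eq_neg_one (h0 : h ≠ 0) (rhe : h * e - e * h = (2 : ℂ) • e)
    (rhf : h * f - f * h = -((2 : ℂ) • f)) (ref : e * f - f * e = h) (cJh : J₁ * h = h * J₁) (cJe : J₁ * e = e * J₁)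
    (cJf : J₁ * f = f * J₁) (hJ : (J₁ + Complex.I • h) * (J₁ + Complex.I • h) = -1) (a b c : ℂ) :
    (a • h + b • e + c • f) * J₁ = 0 := by
  have h1 := sl2Matrix_mul_smul_add_eq_zero_of_sq_eq_neg_one h0 rhe rhf ref cJh cJe cJf hJ a b c
  rw [mul_add, mul_add, mul_smul_comm, mul_smul_comm, mul_smul_comm, cJh, cJe, cJf] at h1
  rw [add_mul, add_mul, smul_mul_assoc, smul_mul_assoc, smul_mul_assoc, h1]

end MatrixForm

/-! ### §6 Coordinates on `ℂ h + ℂ e + ℂ f`: the bracket, `(ad x)³ = 4(α² + βγ) ad x`, `(ad J)³ = -4 ad J` for `J² = -1`,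
and the `𝔰𝔩₂`-triple through an element with `α² + βγ = -1` -/

section Coordinates

variable {A : Type u} [Ring A] [Algebra ℂ A] {h e f : A}

omit [Algebra ℂ A] in
/-- **`(ad J)³ = -4 ad J` for `J² = -1`** (any ring; `ad J = L_J - R_J` with `L_J² = R_J² = -1`).
[cite: MoonenZarhin1999LowDim, §3 Lemma (3.4) (proof: the eigenvalues `±i` of `J`)] -/
theorem adCube_eq_neg_four_smul_of_mul_self_eq_neg_one {J : A} (hJ : J * J = -1) (Y : A) :
    J * (J * (J * Y - Y * J) - (J * Y - Y * J) * J) - (J * (J * Y - Y * J) - (J * Y - Y * J) * J) * J =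
      -(4 • (J * Y - Y * J)) := by
  have h3 : ∀ Z : A, J * (J * Z) = -Z := fun Z ↦ by rw [← mul_assoc, hJ, neg_one_mul]
  simp only [mul_sub, sub_mul, mul_assoc, h3, hJ, mul_neg, mul_one, neg_mul]
  abel

/-- The commutator of two elements of `ℂ h + ℂ e + ℂ f` in coordinates (no relation used).  [folklore] -/
private theorem comm_coords₄₅ (h e f : A) (a b c a' b' c' : ℂ) :
    (a • h + b • e + c • f) * (a' • h + b' • e + c' • f) - (a' • h + b' • e + c' • f) * (a • h + b • e + c • f) =
      (a * b' - a' * b) • (h * e - e * h) + (a * c' - a' * c) • (h * f - f * h) + (b * c' - b' * c) • (e * f - f * e) := by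
  simp only [mul_add, add_mul, smul_mul_assoc, mul_smul_comm, smul_sub]
  module

/-- **The bracket of `ℂ h + ℂ e + ℂ f` in the coordinates of an `𝔰𝔩₂`-triple**:
`[a h + b e + c f, a' h + b' e + c' f] = (b c' - b' c) h + 2 (a b' - a' b) e + 2 (a' c - a c') f` — the bracket of
`𝔰𝔩₂(ℂ)` transported by `(a b; c -a) ↦ a h + b e + c f`. [cite: Bourbaki2008LieGroups79, Ch. VIII §1 no. 1 (`𝔰𝔩(2, k)`)] -/
theorem sl2_comm_smul_add (rhe : h * e - e * h = (2 : ℂ) • e) (rhf : h * f - f * h = -((2 : ℂ) • f))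
    (ref : e * f - f * e = h) (a b c a' b' c' : ℂ) :
    (a • h + b • e + c • f) * (a' • h + b' • e + c' • f) - (a' • h + b' • e + c' • f) * (a • h + b • e + c • f) =
      (b * c' - b' * c) • h + (2 * (a * b' - a' * b)) • e + (2 * (a' * c - a * c')) • f := by
  rw [comm_coords₄₅, rhe, rhf, ref]
  module

/-- **`(ad x)³ s = 4 (α² + β γ) (ad x) s`** for `x = α h + β e + γ f`, `s ∈ ℂ h + ℂ e + ℂ f` (in `𝔰𝔩₂(ℂ)`, `ad X` has the
eigenvalues `0, ±2μ` with `μ² = -det X = α² + βγ`). [cite: Bourbaki2008LieGroups79, Ch. VIII §1 no. 1 (`𝔰𝔩(2, k)`)] -/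
theorem sl2_adCube_smul_add (rhe : h * e - e * h = (2 : ℂ) • e) (rhf : h * f - f * h = -((2 : ℂ) • f))
    (ref : e * f - f * e = h) (α β γ a b c : ℂ) {x s : A} (hx : x = α • h + β • e + γ • f)
    (hs : s = a • h + b • e + c • f) :
    x * (x * (x * s - s * x) - (x * s - s * x) * x) - (x * (x * s - s * x) - (x * s - s * x) * x) * x =
      (4 * (α ^ 2 + β * γ)) • (x * s - s * x) := by
  have h1 : x * s - s * x =
      (β * c - b * γ) • h + (2 * (α * b - a * β)) • e + (2 * (a * γ - α * c)) • f := by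
    rw [hx, hs, sl2_comm_smul_add rhe rhf ref]
  have h2 : x * (x * s - s * x) - (x * s - s * x) * x =
      (β * (2 * (a * γ - α * c)) - 2 * (α * b - a * β) * γ) • h +
        (2 * (α * (2 * (α * b - a * β)) - (β * c - b * γ) * β)) • e +
          (2 * ((β * c - b * γ) * γ - α * (2 * (a * γ - α * c)))) • f := by
    rw [h1, hx, sl2_comm_smul_add rhe rhf ref]
  rw [h2, h1, hx, sl2_comm_smul_add rhe rhf ref]
  module

/-- If `x = α h + β e + γ f` ad-commutes like an element of square `-1` — `(ad x)³ s = -4 (ad x) s` for `s = h, e, f` — and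
does NOT commute with all of `h, e, f`, then `α² + βγ = -1` (`x ↦ (α β; γ -α)` has determinant `1`).
[cite: MoonenZarhin1999LowDim, §3 Lemma (3.4) (proof)] [cite: Bourbaki2008LieGroups79, Ch. VIII §1 no. 1] -/
theorem sl2_sq_add_mul_eq_neg_one_of_adCube (rhe : h * e - e * h = (2 : ℂ) • e) (rhf : h * f - f * h = -((2 : ℂ) • f))
    (ref : e * f - f * e = h) {α β γ : ℂ} {x : A} (hx : x = α • h + β • e + γ • f)
    (had : ∀ s ∈ ({h, e, f} : Set A),
      x * (x * (x * s - s * x) - (x * s - s * x) * x) - (x * (x * s - s * x) - (x * s - s * x) * x) * x = -(4 • (x * s - s * x)))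
    (hnc : ¬ (x * h = h * x ∧ x * e = e * x ∧ x * f = f * x)) : α ^ 2 + β * γ = -1 := by
  by_contra hne
  have hd : (4 * (α ^ 2 + β * γ) + 4 : ℂ) ≠ 0 := by
    intro h0; exact hne (by linear_combination h0 / 4)
  have key : ∀ s ∈ ({h, e, f} : Set A), x * s = s * x := by
    intro s hs
    obtain ⟨a, b, c, hsabc⟩ : ∃ a b c : ℂ, s = a • h + b • e + c • f := by
      simp only [Set.mem_insert_iff, Set.mem_singleton_iff] at hs
      rcases hs with rfl | rfl | rfl
      · exact ⟨1, 0, 0, by simp⟩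
      · exact ⟨0, 1, 0, by simp⟩
      · exact ⟨0, 0, 1, by simp⟩
    have h1 := sl2_adCube_smul_add rhe rhf ref α β γ a b c hx hsabc
    rw [had s hs] at h1
    have h2 : (4 * (α ^ 2 + β * γ) + 4 : ℂ) • (x * s - s * x) = 0 := by
      rw [add_smul, ofNat_smul_eq_nsmul ℂ 4 (x * s - s * x), ← h1, neg_add_cancel]
    rcases smul_eq_zero.1 h2 with h3 | h3
    · exact absurd h3 hd
    · exact sub_eq_zero.1 h3
  exact hnc ⟨key h (by simp), key e (by simp), key f (by simp)⟩

end Coordinates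

/-! ### §7 The `𝔰𝔩₂`-triple through an element of `ℂ h + ℂ e + ℂ f` with `α² + βγ = -1` -/

section AdaptedTriple

/-- The standard triple of `𝔰𝔩₂(ℂ)` decomposes every traceless `2 × 2` matrix. [cite: Bourbaki2008LieGroups79, Ch. VIII §1 no. 1] -/
private theorem fin_two_eq_smul_add₄₅ (Z : Matrix (Fin 2) (Fin 2) ℂ) (hZ : Z 1 1 = -Z 0 0) :
    Z = Z 0 0 • !![(1 : ℂ), 0; 0, -1] + Z 0 1 • !![(0 : ℂ), 1; 0, 0] + Z 1 0 • !![(0 : ℂ), 0; 1, 0] := by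
  ext i j
  fin_cases i <;> fin_cases j <;> simp [hZ]

/-- A traceless `2 × 2` complex matrix `X` with `X² = -1` is conjugate to `diag(i, -i)`: `X g = g · diag(i, -i)` for an
invertible `g` (its columns are eigenvectors for `i` and `-i`). [folklore] -/
private theorem exists_conj_diag_of_mul_self_eq_neg_one₄₅ (X : Matrix (Fin 2) (Fin 2) ℂ) (hX : X 1 1 = -X 0 0)
    (hXX : X * X = -1) :
    ∃ g : Matrix (Fin 2) (Fin 2) ℂ, IsUnit g.det ∧ X * g = g * (Complex.I • !![(1 : ℂ), 0; 0, -1]) := by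
  -- the two eigen-relations `X (X ± i) = ± i (X ± i)`
  have hp : X * (X + Complex.I • (1 : Matrix (Fin 2) (Fin 2) ℂ)) = Complex.I • (X + Complex.I • 1) := by
    rw [mul_add, mul_smul_comm, mul_one, hXX, smul_add, smul_smul, Complex.I_mul_I, neg_one_smul]; abel
  have hm : X * (X - Complex.I • (1 : Matrix (Fin 2) (Fin 2) ℂ)) = (-Complex.I) • (X - Complex.I • 1) := by
    rw [mul_sub, mul_smul_comm, mul_one, hXX, smul_sub, smul_smul, neg_mul, Complex.I_mul_I, neg_neg, one_smul, neg_smul]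
    abel
  -- both `X ± i` are non-zero (trace!)
  have hne : ∀ ε : ℂ, ε ≠ 0 → X + ε • (1 : Matrix (Fin 2) (Fin 2) ℂ) ≠ 0 := by
    intro ε hε h0
    have h00 := congrFun (congrFun h0 0) 0
    have h11 := congrFun (congrFun h0 1) 1
    simp only [Matrix.add_apply, Matrix.smul_apply, Matrix.one_apply_eq, smul_eq_mul, mul_one, Matrix.zero_apply, hX] at h00 h11
    exact hε (by linear_combination (h00 + h11) / 2)
  have hnep := hne Complex.I Complex.I_ne_zero
  have hnem : X - Complex.I • (1 : Matrix (Fin 2) (Fin 2) ℂ) ≠ 0 := by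
    rw [sub_eq_add_neg, ← neg_smul]; exact hne (-Complex.I) (neg_ne_zero.2 Complex.I_ne_zero)
  -- a non-zero column of each
  have hcol : ∀ N : Matrix (Fin 2) (Fin 2) ℂ, N ≠ 0 → ∃ j, (fun i ↦ N i j) ≠ 0 := by
    intro N hN
    by_contra hall
    refine hN (Matrix.ext fun i j ↦ ?_)
    have h1 := not_exists.1 hall j
    rw [ne_eq, not_not] at h1
    exact congrFun h1 i
  obtain ⟨jp, hjp⟩ := hcol _ hnep
  obtain ⟨jm, hjm⟩ := hcol _ hnem
  set vp : Fin 2 → ℂ := fun i ↦ (X + Complex.I • (1 : Matrix (Fin 2) (Fin 2) ℂ)) i jp with hvp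
  set vm : Fin 2 → ℂ := fun i ↦ (X - Complex.I • (1 : Matrix (Fin 2) (Fin 2) ℂ)) i jm with hvm
  have hXvp : X.mulVec vp = Complex.I • vp := by
    funext i
    have h1 := congrFun (congrFun hp i) jp
    rw [Matrix.mul_apply] at h1
    rw [Matrix.mulVec, dotProduct]
    exact h1
  have hXvm : X.mulVec vm = (-Complex.I) • vm := by
    funext i
    have h1 := congrFun (congrFun hm i) jm
    rw [Matrix.mul_apply] at h1
    rw [Matrix.mulVec, dotProduct]
    exact h1
  -- eigenvectors for `i ≠ -i` are independent
  have hI2 : Complex.I ≠ -Complex.I := fun h0 ↦ Complex.I_ne_zero (by linear_combination h0 / 2)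
  have hinj : Function.Injective (![Complex.I, -Complex.I] : Fin 2 → ℂ) := by
    intro i j hij
    fin_cases i <;> fin_cases j
    · rfl
    · exact absurd (by simpa using hij) hI2
    · exact absurd (by simpa using hij) hI2.symm
    · rfl
  have hli : LinearIndependent ℂ ![vp, vm] := by
    refine Module.End.eigenvectors_linearIndependent' (Matrix.toLin' X) ![Complex.I, -Complex.I] hinj ![vp, vm]
      fun i ↦ ?_
    fin_cases i
    · exact ⟨Module.End.mem_eigenspace_iff.2 (by simpa [Matrix.toLin'_apply] using hXvp), hjp⟩
    · exact ⟨Module.End.mem_eigenspace_iff.2 (by simpa [Matrix.toLin'_apply] using hXvm), hjm⟩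
  set G : Matrix (Fin 2) (Fin 2) ℂ := Matrix.of ![vp, vm] with hG
  have hGu : IsUnit G := Matrix.linearIndependent_rows_iff_isUnit.1 (by simpa [hG] using hli)
  refine ⟨G.transpose, ?_, ?_⟩
  · rw [Matrix.det_transpose]; exact (Matrix.isUnit_iff_isUnit_det G).1 hGu
  · ext i k
    have ep := congrFun hXvp i
    have em := congrFun hXvm i
    simp only [Matrix.mulVec, dotProduct, Fin.sum_univ_two, Pi.smul_apply, smul_eq_mul] at ep em
    fin_cases k <;>
      simp [Matrix.mul_apply, Fin.sum_univ_two, Matrix.transpose_apply, hG, Matrix.of_apply, ep, em, mul_comm]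

/-- Conjugation by an invertible `g` is multiplicative. [folklore] -/
private theorem conj_mul_conj₄₅ {g : Matrix (Fin 2) (Fin 2) ℂ} (hg : IsUnit g.det) (P Q : Matrix (Fin 2) (Fin 2) ℂ) :
    g * P * g⁻¹ * (g * Q * g⁻¹) = g * (P * Q) * g⁻¹ := by
  rw [Matrix.mul_assoc (g * P), ← Matrix.mul_assoc g⁻¹, ← Matrix.mul_assoc g⁻¹, Matrix.nonsing_inv_mul _ hg,
    Matrix.one_mul, ← Matrix.mul_assoc, Matrix.mul_assoc g P]

variable {A : Type u} [Ring A] [Algebra ℂ A] {h e f : A}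

/-- The coordinate map `(a b; c -a) ↦ a h + b e + c f` is multiplicative on brackets of traceless matrices.
[cite: Bourbaki2008LieGroups79, Ch. VIII §1 no. 1 (`𝔰𝔩(2, k)`)] -/
private theorem bracket_coords₄₅ (rhe : h * e - e * h = (2 : ℂ) • e) (rhf : h * f - f * h = -((2 : ℂ) • f))
    (ref : e * f - f * e = h) (Y Z : Matrix (Fin 2) (Fin 2) ℂ) (hY : Y 1 1 = -Y 0 0) (hZ : Z 1 1 = -Z 0 0) :
    (Y 0 0 • h + Y 0 1 • e + Y 1 0 • f) * (Z 0 0 • h + Z 0 1 • e + Z 1 0 • f) -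
        (Z 0 0 • h + Z 0 1 • e + Z 1 0 • f) * (Y 0 0 • h + Y 0 1 • e + Y 1 0 • f) =
      (Y * Z - Z * Y) 0 0 • h + (Y * Z - Z * Y) 0 1 • e + (Y * Z - Z * Y) 1 0 • f := by
  rw [sl2_comm_smul_add rhe rhf ref]
  simp only [Matrix.sub_apply, Matrix.mul_apply, Fin.sum_univ_two, hY, hZ]
  module

/-- **THE `𝔰𝔩₂`-TRIPLE THROUGH AN ELEMENT OF DETERMINANT ONE.**  Let `(h, e, f)` satisfy the `𝔰𝔩₂`-relations in a
`ℂ`-algebra and let `x = α h + β e + γ f` with `α² + βγ = -1` (the matrix `X = (α β; γ -α)` has `X² = -1`).  Then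
`h' = -i x` is the neutral element of an `𝔰𝔩₂`-triple `(h', e', f')` with `e', f' ∈ ℂ h + ℂ e + ℂ f`, and every
`a h + b e + c f` is `a' h' + b' e' + c' f'` with `a'² + b'c' = a² + bc` (conjugate `(H, E, F)` by the matrix `g`
diagonalising `X`; the determinant is conjugation invariant). [cite: Bourbaki2008LieGroups79, Ch. VIII §1 no. 1 and §11 no. 1]
[cite: MoonenZarhin1999LowDim, §3 Lemma (3.4) (proof)] -/
theorem sl2_exists_triple_through (rhe : h * e - e * h = (2 : ℂ) • e) (rhf : h * f - f * h = -((2 : ℂ) • f))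
    (ref : e * f - f * e = h) {α β γ : ℂ} (hd : α ^ 2 + β * γ = -1) :
    ∃ a₁ b₁ c₁ a₂ b₂ c₂ : ℂ,
      (-Complex.I • (α • h + β • e + γ • f)) * (a₁ • h + b₁ • e + c₁ • f) -
          (a₁ • h + b₁ • e + c₁ • f) * (-Complex.I • (α • h + β • e + γ • f)) = (2 : ℂ) • (a₁ • h + b₁ • e + c₁ • f) ∧
      (-Complex.I • (α • h + β • e + γ • f)) * (a₂ • h + b₂ • e + c₂ • f) -
          (a₂ • h + b₂ • e + c₂ • f) * (-Complex.I • (α • h + β • e + γ • f)) = -((2 : ℂ) • (a₂ • h + b₂ • e + c₂ • f)) ∧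
      (a₁ • h + b₁ • e + c₁ • f) * (a₂ • h + b₂ • e + c₂ • f) - (a₂ • h + b₂ • e + c₂ • f) * (a₁ • h + b₁ • e + c₁ • f) =
          -Complex.I • (α • h + β • e + γ • f) ∧
      ∀ a b c : ℂ, ∃ a' b' c' : ℂ,
        a • h + b • e + c • f =
            a' • (-Complex.I • (α • h + β • e + γ • f)) + b' • (a₁ • h + b₁ • e + c₁ • f) + c' • (a₂ • h + b₂ • e + c₂ • f) ∧
          a' ^ 2 + b' * c' = a ^ 2 + b * c := by
  -- the coordinate map
  let ψ : Matrix (Fin 2) (Fin 2) ℂ → A := fun Y ↦ Y 0 0 • h + Y 0 1 • e + Y 1 0 • f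
  have ψ_add : ∀ Y Z, ψ (Y + Z) = ψ Y + ψ Z := fun Y Z ↦ by
    simp only [ψ, Matrix.add_apply, add_smul]; abel
  have ψ_smul : ∀ (c : ℂ) Y, ψ (c • Y) = c • ψ Y := fun c Y ↦ by
    simp only [ψ, Matrix.smul_apply, smul_eq_mul, smul_add, smul_smul]
  have ψ_br : ∀ Y Z : Matrix (Fin 2) (Fin 2) ℂ, Y 1 1 = -Y 0 0 → Z 1 1 = -Z 0 0 →
      ψ Y * ψ Z - ψ Z * ψ Y = ψ (Y * Z - Z * Y) := fun Y Z hY hZ ↦ bracket_coords₄₅ rhe rhf ref Y Z hY hZ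
  -- the matrix `X` of `x` and its diagonaliser
  set X : Matrix (Fin 2) (Fin 2) ℂ := !![α, β; γ, -α] with hXdef
  have hX : X 1 1 = -X 0 0 := by simp [hXdef]
  have hXX : X * X = -1 := by
    ext i j
    fin_cases i <;> fin_cases j
    · simp [hXdef, Matrix.mul_apply, Fin.sum_univ_two]; linear_combination hd
    · simp [hXdef, Matrix.mul_apply, Fin.sum_univ_two]; ring
    · simp [hXdef, Matrix.mul_apply, Fin.sum_univ_two]; ring
    · simp [hXdef, Matrix.mul_apply, Fin.sum_univ_two]; linear_combination hd
  have hψX : ψ X = α • h + β • e + γ • f := by simp [ψ, hXdef]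
  obtain ⟨g, hg, hgX⟩ := exists_conj_diag_of_mul_self_eq_neg_one₄₅ X hX hXX
  set H₀ : Matrix (Fin 2) (Fin 2) ℂ := !![(1 : ℂ), 0; 0, -1] with hH₀
  set E₀ : Matrix (Fin 2) (Fin 2) ℂ := !![(0 : ℂ), 1; 0, 0] with hE₀
  set F₀ : Matrix (Fin 2) (Fin 2) ℂ := !![(0 : ℂ), 0; 1, 0] with hF₀
  have rHE : H₀ * E₀ - E₀ * H₀ = (2 : ℂ) • E₀ := by
    ext i j; fin_cases i <;> fin_cases j <;> norm_num [hH₀, hE₀]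
  have rHF : H₀ * F₀ - F₀ * H₀ = -((2 : ℂ) • F₀) := by
    ext i j; fin_cases i <;> fin_cases j <;> norm_num [hH₀, hF₀]
  have rEF : E₀ * F₀ - F₀ * E₀ = H₀ := by
    ext i j; fin_cases i <;> fin_cases j <;> norm_num [hH₀, hE₀, hF₀]
  set H' := g * H₀ * g⁻¹ with hH'
  set E' := g * E₀ * g⁻¹ with hE'
  set F' := g * F₀ * g⁻¹ with hF'
  have hgg : g * g⁻¹ = 1 := Matrix.mul_nonsing_inv _ hg
  have hg'g : g⁻¹ * g = 1 := Matrix.nonsing_inv_mul _ hg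
  -- traces
  have htr : ∀ P : Matrix (Fin 2) (Fin 2) ℂ, P 1 1 = -P 0 0 → (g * P * g⁻¹) 1 1 = -(g * P * g⁻¹) 0 0 := by
    intro P hP
    have h1 : (g * P * g⁻¹).trace = P.trace := by
      rw [Matrix.trace_mul_cycle, hg'g, Matrix.one_mul]
    rw [Matrix.trace_fin_two, Matrix.trace_fin_two, hP, add_neg_cancel] at h1
    exact eq_neg_of_add_eq_zero_right h1
  have htr' : ∀ P : Matrix (Fin 2) (Fin 2) ℂ, P 1 1 = -P 0 0 → (g⁻¹ * P * g) 1 1 = -(g⁻¹ * P * g) 0 0 := by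
    intro P hP
    have h1 : (g⁻¹ * P * g).trace = P.trace := by
      rw [Matrix.trace_mul_cycle, hgg, Matrix.one_mul]
    rw [Matrix.trace_fin_two, Matrix.trace_fin_two, hP, add_neg_cancel] at h1
    exact eq_neg_of_add_eq_zero_right h1
  have hH'tr : H' 1 1 = -H' 0 0 := htr H₀ (by simp [hH₀])
  have hE'tr : E' 1 1 = -E' 0 0 := htr E₀ (by simp [hE₀])
  have hF'tr : F' 1 1 = -F' 0 0 := htr F₀ (by simp [hF₀])
  -- `H' = -i X`
  have hH'X : H' = -Complex.I • X := by
    have h1 : g * H₀ = -Complex.I • (X * g) := by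
      rw [hgX, Matrix.mul_smul, smul_smul, neg_mul, Complex.I_mul_I, neg_neg, one_smul]
    rw [hH', h1, smul_mul_assoc, Matrix.mul_assoc, hgg, Matrix.mul_one]
  have hψH' : ψ H' = -Complex.I • (α • h + β • e + γ • f) := by rw [hH'X, ψ_smul, hψX]
  -- relations of the conjugated triple
  have rH'E' : H' * E' - E' * H' = (2 : ℂ) • E' := by
    rw [hH', hE', conj_mul_conj₄₅ hg, conj_mul_conj₄₅ hg, ← Matrix.sub_mul, ← Matrix.mul_sub, rHE, Matrix.mul_smul,
      Matrix.smul_mul]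
  have rH'F' : H' * F' - F' * H' = -((2 : ℂ) • F') := by
    rw [hH', hF', conj_mul_conj₄₅ hg, conj_mul_conj₄₅ hg, ← Matrix.sub_mul, ← Matrix.mul_sub, rHF, Matrix.mul_neg,
      Matrix.neg_mul, Matrix.mul_smul, Matrix.smul_mul]
  have rE'F' : E' * F' - F' * E' = H' := by
    rw [hH', hE', hF', conj_mul_conj₄₅ hg, conj_mul_conj₄₅ hg, ← Matrix.sub_mul, ← Matrix.mul_sub, rEF]
  refine ⟨E' 0 0, E' 0 1, E' 1 0, F' 0 0, F' 0 1, F' 1 0, ?_, ?_, ?_, fun a b c ↦ ?_⟩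
  · rw [← hψH']
    show ψ H' * ψ E' - ψ E' * ψ H' = (2 : ℂ) • ψ E'
    rw [ψ_br H' E' hH'tr hE'tr, rH'E', ψ_smul]
  · rw [← hψH']
    show ψ H' * ψ F' - ψ F' * ψ H' = -((2 : ℂ) • ψ F')
    rw [ψ_br H' F' hH'tr hF'tr, rH'F', ← neg_smul, ψ_smul, neg_smul]
  · rw [← hψH']
    show ψ E' * ψ F' - ψ F' * ψ E' = ψ H'
    rw [ψ_br E' F' hE'tr hF'tr, rE'F']
  · -- coordinates of `Y = (a b; c -a)` in the conjugated triple
    set Y : Matrix (Fin 2) (Fin 2) ℂ := !![a, b; c, -a] with hYdef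
    set Z := g⁻¹ * Y * g with hZ
    have hZtr : Z 1 1 = -Z 0 0 := htr' Y (by simp [hYdef])
    have hYZ : Y = Z 0 0 • H' + Z 0 1 • E' + Z 1 0 • F' := by
      have h1 : g * Z * g⁻¹ = Y := by
        rw [hZ, ← Matrix.mul_assoc, ← Matrix.mul_assoc, hgg, Matrix.one_mul, Matrix.mul_assoc, hgg, Matrix.mul_one]
      rw [← h1]
      conv_lhs => rw [fin_two_eq_smul_add₄₅ Z hZtr]
      rw [hH', hE', hF']
      simp only [Matrix.mul_add, Matrix.add_mul, Matrix.mul_smul, Matrix.smul_mul]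
      rfl
    refine ⟨Z 0 0, Z 0 1, Z 1 0, ?_, ?_⟩
    · have h1 : ψ Y = a • h + b • e + c • f := by simp [ψ, hYdef]
      rw [← h1, hYZ, ψ_add, ψ_add, ψ_smul, ψ_smul, ψ_smul, ← hψH']
    · have hdet : Z.det = Y.det := by
        rw [hZ, Matrix.det_mul, Matrix.det_mul, mul_comm, ← mul_assoc, mul_comm g.det, Matrix.det_nonsing_inv_mul_det _ hg,
          one_mul]
      rw [Matrix.det_fin_two, Matrix.det_fin_two, hZtr] at hdet
      simp only [hYdef, Matrix.of_apply, Matrix.cons_val', Matrix.cons_val_zero, Matrix.cons_val_one,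
        Matrix.cons_val_fin_one, Matrix.empty_val'] at hdet
      linear_combination -hdet

end AdaptedTriple

end Literature.Algebra.Lie
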